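import Literature.AlgebraicGeometry.HodgeTheory.UnitaryTwoOneTimesCMCurveWeilClasses
import Literature.AlgebraicGeometry.HodgeTheory.CodimTwoDivisorPullbackGenerated
import Literature.AlgebraicGeometry.Motives.HodgeThetaAnnihilatorUnitaryTimesAbelianCommutant
import HarnessLib

/-!
# `T × E × E`, `T` a threefold of unitary type `(2,1)` over `End⁰(T) = ℚ(√-d)`, `E` an elliptic curve with complex multiplication: `B²(T × E²) ⊆ D² + α₁^* B²(T × E) + α₂^* B²(T × E)` (Moonen–Zarhin 1999 Thm. 0.2 (1), case (e) ∩ (a1); §5 (5.3), (5.12))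

Family `hodge`, layer `Literature/AlgebraicGeometry/HodgeTheory`. Research context: cell `pub-hodge-ring2` (HONEST
FRAMING: research route conditional on HC_CM; not a corollary; Q11.4-sentence-2 already refuted in dim ≥ 3),
Literature lane (lit gen 66), programme R41 — the companion of `UnitaryTwoOneTimesCMCurveWeilClasses` (R30: `T × E`,
ONE CM elliptic curve, Thm. 0.1 (1) case (a1)) for the SQUARE `E × E`, Moonen–Zarhin's case (e): `X ∼ X₁² × X₂`.
Lie step: the tree's R41-L `Motives/HodgeThetaAnnihilatorUnitaryTimesAbelianCommutant` (the annihilator of a Hodge class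
on `T × S` contains `ι_T 𝔰𝔲_k(H¹T, ψ) π_T` as soon as the skew Hodge-commutant of `H¹(S)` is abelian — «`Hg(X) ⊃ {1} ×
SU_{F/k}(V₂,ψ)`», (5.12) with (5.3)). UNCONDITIONAL (no HC_CM, no Weil-class input); theorems only (no definition, no
named fact, D-0026; nothing admitted); it discharges nothing of the tree's named fact
`MoonenZarhin1999_codimTwoHodgeClasses_abelianFivefold` by itself but proves its residual clause «(e) ∩ (a1)» pointwise
(`isCodimTwoDivisorPullbackGenerated_of_caseE_a1`, the exact binder shape of the cell's census).

PRINTED RESULT. B. Moonen, Yu. Zarhin, *Hodge classes on abelian varieties of low dimension*, Math. Ann. 315 (1999)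
711–733 [held: `paper:arxiv-math_9901113`], Thm. 0.2 (chunk p0001 L125–L165): «Let `X` be a complex abelian variety
with `dim(X) ≤ 5`. … (e) The abelian variety `X` is isogenous to a product `X₁² × X₂`, where `X₁` and `X₂` are as in
(a)» [(a): `X₁` an elliptic curve with `End⁰(X₁) = k` imaginary quadratic, `X₂` a simple abelian threefold with an
embedding `k ↪ End⁰(X₂)` acting with multiplicities `(2,1)`; (a1): `End⁰(X₂) = k`] «(1) Suppose we are in case (e).
Let `α : X → X₁ × X₂` be a surjective homomorphism, and write `W_{k,α} := α^* W_k …`. Then the Hodge ring `B•(X)` is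
generated by the subalgebra `D•(X)` of divisor classes together with the subspaces `W_{k,α}`, where `α` runs through
the set of surjective homomorphisms `X → X₁ × X₂`.» Taking parts (1)–(4) of Thm. 0.2 together: in all cases of Thm. 0.2,
`B²(X) = D²(X) + Σ_α α^* B²(X')` over surjections onto FOURFOLDS `X'` — the tree's predicate
`IsCodimTwoDivisorPullbackGenerated`. Proof printed in §5 (5.12) (chunk p0011 L19–L78): «we have `X ∼ X₁² × X₂` …
`Hg(X) ≅ Hg(X₁ × X₂)` … the Hodge classes in `(H¹ ⊗ H³) ⊕ (H³ ⊗ H¹)` … `H¹(X₁²) ⊗ H³(X₂) = α₁^*(…) ⊕ α₂^*(…)` …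
To settle case (e) it thus remains to compute the Hodge classes in `H² ⊗ H²` … `Hg(X) ⊃ {1} × SU_{F/k}(V₂,ψ)`, so that
the Hodge classes in `H² ⊗ H²` are contained in `H²(X₁²,ℚ) ⊗ B¹(X₂)`.»

THIS FILE (codimension two only — the degree the fivefold census needs):
* §1 `kindWeight_eq_zero_or_card_isLeft_eq_of_rootDiffWeights`: the word-combinatorial core of `𝔰𝔲_k(V_T)`,
  multiplicities `(2,1)`, next to ANY number of further pairs: a word without repeated letters killed by the
  root-difference weights is `T`-kind balanced or carries exactly one letter from each `T`-pair.
* §2 `mul_comm_of_commute_cornerUnits`, `mul_comm_of_commute_of_mul_self_eq_neg`,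
  `HOneProduct.mul_comm_of_commute_endAlg_cmCurve_prod_self`: the Hodge-commutant of `H¹(E × E; ℚ)` is abelian
  (`End_Hdg ⊇ M₂(ℚ(χ^*))`, commutant `ℚ(χ^*)`).
* §3 `AVSlots.exists_coeff_eq_zero_off_balanced_or_onePerPair_of_prod_unitaryTwoOne_abelianCommutant`: the
  invariance theorem for one slot over `T × S`, `S` ANY abelian variety with abelian skew Hodge-commutant of `H¹(S)`
  (R30's §2 verbatim up to the Lie step and the core).
* §5 `mem_divisorClassesSpan_sup_span_pullbacks_of_unitaryTwoOne_cmCurve_sq` (sharp form, the two named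
  surjections `α_a = 𝟙 × pr_a`) and `isCodimTwoDivisorPullbackGenerated_prod_cmCurve_sq_of_unitaryTwoOne`:
  `B²(T × E × E) ⊆ D² + α₁^* B²(T × E) + α₂^* B²(T × E)` — the unbalanced words are the Künneth component of
  `S`-degree `1` (rational, type `(2,2)`), equal to `α₁^* σ₁^*(·) + α₂^* σ₂^*(·)` by `pr₁ ≫ ι₁ + pr₂ ≫ ι₂ = 𝟙_{E×E}`
  and the additivity of `H¹` pull-backs; the balanced words give products of divisor classes (`B(T) = D(T)`,
  `B(E²) = D(E²)`, `dim ≤ 3`); `hodgeConjectureFor_prod_cmCurve_sq_of_unitaryTwoOne_of_hodgeConjectureFor`: HC for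
  `T × E × E` from HC for the fourfold `T × E` (hypothesis), by Lefschetz `(1,1)` and hard Lefschetz.
* §6 the printed hypotheses: `T` simple with `dim_ℚ End⁰(T) = 2` (type IV(1,1) by Shimura's positivity, the tree's
  `AbelianVariety.eigenMultiplicity_pos_of_isSimple`), `E` of CM type, every `X ∼ E × E × T` (the predicate, and HC
  from HC for `T × E`); and the residual clause «(e) ∩ (a1)» of the cell's census in its exact binder shape
  (`isCodimTwoDivisorPullbackGenerated_of_caseE_a1`).
NOT covered / not asserted: the identification of the two pull-backs with the Weil classes `W_{k,α_a}` and the full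
Hodge ring statement of Thm. 0.2 (1) in codimension `3`; `D² ≠ B²`; case (a2) (`End⁰(X₂) = F` sextic); the
algebraicity of `W_k` (Markman 2025 / Schoen; the tree's named fact for fourfolds, not used here). No hypothesis
`End⁰(E) ↪ End⁰(T)` is needed for the codimension-two inclusion (for `ℚ(χ) ≠ ℚ(√-d)` it is Thm. 0.2 (4), `B = D`).

## References

* [MoonenZarhin1999LowDim] B. Moonen, Yu. Zarhin, Math. Ann. 315 (1999), Thm. 0.2 (1) with case (e), (2.3), (2.5),
  §3 (3.1), Lemma (3.6), §5 (5.3), (5.12) (item numbers as printed in arXiv:math/9901113v2; held `paper:arxiv-math_9901113` chunks p0001, p0004–p0007, p0009,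
  p0011). [cite: MoonenZarhin1999LowDim, Thm. 0.2 (1) with case (e) and §5 (5.3), (5.12)]
* [vanGeemen1994HodgeAV] B. van Geemen, LNM 1594 (1994), 3.6–3.7, 4.9. [cite: vanGeemen1994HodgeAV, 4.9]
* [Deligne1982HodgeCycles] P. Deligne, LNM 900 (1982), I §3 Prop. 3.4. [cite: Deligne1982HodgeCycles, I §3 Prop. 3.4]
* [Lombardo2016] D. Lombardo, Ann. Inst. Fourier 66 (2016), Lemma 3.4 (p. 1229). [cite: Lombardo2016, Lemma 3.4 (p. 1229)]
* [Ribet1983] K. Ribet, Amer. J. Math. 105 (1983), Thm. 3. [cite: Ribet1983, Thm. 3]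
* [Shimura1963AnalyticFamilies] G. Shimura, Ann. of Math. 78 (1963), §4 Prop. 14. [cite: Shimura1963AnalyticFamilies, §4 Prop. 14]
* [GoodmanWallachGTM255] R. Goodman, N. Wallach, GTM 255, §4.1.1. [cite: GoodmanWallachGTM255, §4.1.1]
* [HatcherAT2002] A. Hatcher, *Algebraic Topology*, §3.2 Prop. 3.10, Thm. 3.16. [cite: HatcherAT2002, §3.2 Thm. 3.16]
* [LangeBirkenhake1992] H. Lange, Ch. Birkenhake, *Complex Abelian Varieties*, §1.1 (p. 19). [cite: LangeBirkenhake1992, §1.1 (p. 19)]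
* [Lange2023AbelianVarietiesC] H. Lange, *Abelian Varieties over the Complex Numbers* (2023), Cor. 2.4.26. [cite: Lange2023AbelianVarietiesC, Cor. 2.4.26]
-/

noncomputable section

open scoped TensorProduct
open CategoryTheory Module

namespace Literature.AlgebraicGeometry.HodgeTheory

open Literature.AlgebraicTopology.SingularHomology
open Literature.AlgebraicGeometry.Motives (IsSmoothProjective AbelianVariety bettiCohomology
  ofRatClassBaseChange ofRatClassBaseChange_tmul HodgeTensorFacts hodgeTensorFacts_holds ComplexPoints)
open Literature.Barriers.HodgeConjecture
open Literature.AlgebraicGeometry.Motives.HodgeStructure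
open Literature.AlgebraicGeometry.ComplexMultiplication
open Literature.RepresentationTheory.GeneralLinear
open Literature.NumberTheory.DiophantineGeometry

/-! ### §1 Word combinatorics of `𝔰𝔲_k(V_T)`, multiplicities `(2,1)`, next to ANY number of further pairs: the dichotomy -/

section Combinatorics

variable {hY h d : ℕ}

/-- `∑_t (±1 by kind) = #(kind 0) - #(kind 1)` over any finset of positions. [folklore] -/
private theorem sum_kindSign_eq_card_sub_card_sq (s : Finset (Fin d)) (η : Fin d → Fin 2) :
    ∑ t ∈ s, (if η t = 0 then (1 : ℤ) else -1) =
      ((s.filter fun t => η t = 0).card : ℤ) - ((s.filter fun t => η t = 1).card : ℤ) := by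
  rw [Finset.card_filter, Finset.card_filter, Nat.cast_sum, Nat.cast_sum, ← Finset.sum_sub_distrib]
  refine Finset.sum_congr rfl fun t _ => ?_
  rcases Fin.exists_fin_two.1 ⟨η t, rfl⟩ with h0 | h1
  · simp [h0]
  · simp [h1]

/-- In `Fin 2`, `x ≠ r` forces `x = 1 - r`. [folklore] -/
private theorem fin2_eq_one_sub_of_ne_sq : ∀ {x r : Fin 2}, x ≠ r → x = 1 - r := by decide

/-- In `Fin 2`, `1 - r ≠ r`. [folklore] -/
private theorem fin2_one_sub_ne_sq : ∀ r : Fin 2, 1 - r ≠ r := by decide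

/-- The two elements of `Fin 2`. [folklore] -/
private theorem fin2_eq_zero_or_one_sq (r : Fin 2) : r = 0 ∨ r = 1 := by
  fin_cases r <;> simp

/-- In a word without repeated letters, at most one position carries a given letter `(place, kind)`. [folklore] -/
private theorem card_filter_place_kind_le_one_sq (P : Fin d → Fin hY ⊕ Fin h) (η : Fin d → Fin 2)
    (hinj : Function.Injective fun t => (P t, η t)) (q : Fin hY ⊕ Fin h) (r : Fin 2) :
    (Finset.univ.filter fun t => P t = q ∧ η t = r).card ≤ 1 := by
  refine Finset.card_le_one.2 fun t ht t' ht' => ?_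
  have h1 := (Finset.mem_filter.1 ht).2
  have h2 := (Finset.mem_filter.1 ht').2
  exact hinj (Prod.ext (h1.1.trans h2.1.symm) (h1.2.trans h2.2.symm))

/-- **The word-combinatorial core for multiplicities `(2,1)` next to an arbitrary number of further pairs — the
dichotomy** (Moonen–Zarhin §5 (5.12) with (5.3): «`Hg(X) ⊃ {1} × SU_{F/k}(V₂,ψ)`» on ONE copy of
`H¹(T) ⊕ H¹(S)`). Places `Fin hY ⊕ Fin h` (`h` ARBITRARY: the pairs of `H¹(S)`), kinds `κ` of the `T`-pairs with
`#{κ = 0} = #{κ = 1} + 1`, a word `t ↦ (P t, η t)` WITHOUT REPEATED LETTERS killed by every root-difference weight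
`E_ii - E_jj` of `𝔰𝔩(W)` (`W`-sign `+1` iff `η t = κ ℓ`; the `S`-letters have weight `0`). Then EITHER its `T`-kind
weight vanishes, OR the word carries EXACTLY ONE letter from every `T`-pair — so that its number of `T`-positions is
`hY`. Proof: the signed contents `c_ℓ = n⁺_ℓ - n⁻_ℓ ∈ {-1,0,1}` (`n^±_ℓ ≤ 1`) have a common value `c`, the `T`-kind
weight is `c · (#{κ=0} - #{κ=1}) = c`, and `c = ±1` forces `n⁺_ℓ + n⁻_ℓ = 1` for every `ℓ`. (The tree's
`kindWeight_eq_zero_or_weilWord_of_rootDiffWeights` is the case `h ≤ 1` with the `Θ`-balance added, where the second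
alternative is a `±`-Weil word.) [cite: MoonenZarhin1999LowDim, Thm. 0.2 (1) with case (e) and §5 (5.3), (5.12)]
[cite: GoodmanWallachGTM255, §4.1.1] -/
theorem kindWeight_eq_zero_or_card_isLeft_eq_of_rootDiffWeights (κ : Fin hY → Fin 2) (P : Fin d → Fin hY ⊕ Fin h)
    (η : Fin d → Fin 2) (hinj : Function.Injective fun t => (P t, η t))
    (hκ : (Finset.univ.filter fun ℓ => κ ℓ = 0).card = (Finset.univ.filter fun ℓ => κ ℓ = 1).card + 1)
    (hD : ∀ i j : Fin hY, ∑ t, Sum.elim (fun ℓ => (if η t = κ ℓ then (1 : ℤ) else -1) *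
        ((if ℓ = i then (1 : ℤ) else 0) - (if ℓ = j then (1 : ℤ) else 0))) (fun _ => (0 : ℤ)) (P t) = 0) :
    (∑ t, Sum.elim (fun _ => if η t = 0 then (1 : ℤ) else -1) (fun _ => (0 : ℤ)) (P t) = 0) ∨
    Fintype.card {t // (P t).isLeft = true} = hY := by
  classical
  -- the signed content `c ℓ` of the pair `ℓ`
  set c : Fin hY → ℤ := fun ℓ => ∑ t, Sum.elim (fun ℓ' => if ℓ' = ℓ then (if η t = κ ℓ' then (1 : ℤ) else -1) else 0)
    (fun _ => (0 : ℤ)) (P t) with hc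
  -- (1) `c i = c j`
  have hcc : ∀ i j, c i = c j := by
    intro i j
    have h := hD i j
    have hsplit : ∀ t, Sum.elim (fun ℓ => (if η t = κ ℓ then (1 : ℤ) else -1) *
        ((if ℓ = i then (1 : ℤ) else 0) - (if ℓ = j then (1 : ℤ) else 0))) (fun _ => (0 : ℤ)) (P t) =
        Sum.elim (fun ℓ' => if ℓ' = i then (if η t = κ ℓ' then (1 : ℤ) else -1) else 0) (fun _ => (0 : ℤ)) (P t) -
        Sum.elim (fun ℓ' => if ℓ' = j then (if η t = κ ℓ' then (1 : ℤ) else -1) else 0) (fun _ => (0 : ℤ)) (P t) := by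
      intro t
      rcases P t with ℓ | e
      · simp only [Sum.elim_inl]
        split_ifs <;> ring
      · simp
    simp only [hsplit, Finset.sum_sub_distrib] at h
    exact sub_eq_zero.1 h
  -- (1') `c ℓ = n⁺_ℓ - n⁻_ℓ` with `n^±_ℓ ≤ 1` the number of `W` / `W^⊥`-members of the pair `ℓ` in the word
  have hcℓ : ∀ ℓ, c ℓ = ((Finset.univ.filter fun t => P t = Sum.inl ℓ ∧ η t = κ ℓ).card : ℤ) -
      ((Finset.univ.filter fun t => P t = Sum.inl ℓ ∧ η t = 1 - κ ℓ).card : ℤ) := by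
    intro ℓ
    rw [hc, Finset.card_filter, Finset.card_filter, Nat.cast_sum, Nat.cast_sum, ← Finset.sum_sub_distrib]
    refine Finset.sum_congr rfl fun t _ => ?_
    rcases hP : P t with ℓ' | e
    · by_cases hℓ : ℓ' = ℓ
      · subst hℓ
        simp only [Sum.elim_inl, if_true, true_and]
        rcases Fin.exists_fin_two.1 ⟨η t, rfl⟩ with h0 | h0 <;>
          rcases Fin.exists_fin_two.1 ⟨κ ℓ', rfl⟩ with k0 | k0 <;> simp [h0, k0]
      · have hne : ¬ (Sum.inl ℓ' : Fin hY ⊕ Fin h) = Sum.inl ℓ := fun h' => hℓ (Sum.inl_injective h')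
        simp [hℓ, hne]
    · simp
  have hn1 : ∀ ℓ, (Finset.univ.filter fun t => P t = Sum.inl ℓ ∧ η t = κ ℓ).card ≤ 1 := fun ℓ =>
    card_filter_place_kind_le_one_sq P η hinj _ _
  have hn2 : ∀ ℓ, (Finset.univ.filter fun t => P t = Sum.inl ℓ ∧ η t = 1 - κ ℓ).card ≤ 1 := fun ℓ =>
    card_filter_place_kind_le_one_sq P η hinj _ _
  -- (1'') the number of letters of the pair `ℓ` is `n⁺_ℓ + n⁻_ℓ`
  have hNℓ : ∀ ℓ, (Finset.univ.filter fun t => P t = Sum.inl ℓ).card =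
      (Finset.univ.filter fun t => P t = Sum.inl ℓ ∧ η t = κ ℓ).card +
        (Finset.univ.filter fun t => P t = Sum.inl ℓ ∧ η t = 1 - κ ℓ).card := by
    intro ℓ
    rw [← Finset.card_filter_add_card_filter_not (s := Finset.univ.filter fun t => P t = Sum.inl ℓ)
      (fun t => η t = κ ℓ), Finset.filter_filter, Finset.filter_filter]
    congr 1
    refine congrArg Finset.card (Finset.filter_congr fun t _ => ?_)
    refine and_congr_right fun _ => ⟨fun hne => fin2_eq_one_sub_of_ne_sq hne, fun h' h'' => ?_⟩
    rw [h''] at h'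
    exact fin2_one_sub_ne_sq (κ ℓ) h'.symm
  -- (2) the `T`-kind weight is `∑_ℓ sgn(κ ℓ) · c ℓ`
  have hKW : ∑ t, Sum.elim (fun _ => if η t = 0 then (1 : ℤ) else -1) (fun _ => (0 : ℤ)) (P t) =
      ∑ ℓ, (if κ ℓ = 0 then (1 : ℤ) else -1) * c ℓ := by
    have hpt : ∀ t, Sum.elim (fun _ => if η t = 0 then (1 : ℤ) else -1) (fun _ => (0 : ℤ)) (P t) =
        ∑ ℓ, (if κ ℓ = 0 then (1 : ℤ) else -1) *
          Sum.elim (fun ℓ' => if ℓ' = ℓ then (if η t = κ ℓ' then (1 : ℤ) else -1) else 0) (fun _ => (0 : ℤ)) (P t) := by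
      intro t
      rcases P t with ℓ₀ | e
      · simp only [Sum.elim_inl, mul_ite, mul_zero, Finset.sum_ite_eq, Finset.mem_univ, if_true]
        rcases Fin.exists_fin_two.1 ⟨η t, rfl⟩ with h0 | h0 <;>
          rcases Fin.exists_fin_two.1 ⟨κ ℓ₀, rfl⟩ with k0 | k0 <;> simp [h0, k0]
      · simp
    simp only [hpt]
    rw [Finset.sum_comm]
    refine Finset.sum_congr rfl fun ℓ _ => ?_
    rw [← Finset.mul_sum]
  -- (3) `∑_ℓ sgn(κ ℓ) = #{κ=0} - #{κ=1} = 1`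
  have hsgn : ∑ ℓ, (if κ ℓ = 0 then (1 : ℤ) else -1) = 1 := by
    rw [sum_kindSign_eq_card_sub_card_sq Finset.univ κ, hκ]; push_cast; ring
  rcases isEmpty_or_nonempty (Fin hY) with hemp | ⟨⟨ℓ₀⟩⟩
  · simp only [Finset.univ_eq_empty, Finset.filter_empty, Finset.card_empty] at hκ
    exact absurd hκ (by omega)
  have hconst : ∀ ℓ, c ℓ = c ℓ₀ := fun ℓ => hcc ℓ ℓ₀
  have hKW' : ∑ t, Sum.elim (fun _ => if η t = 0 then (1 : ℤ) else -1) (fun _ => (0 : ℤ)) (P t) = c ℓ₀ := by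
    rw [hKW]
    calc ∑ ℓ, (if κ ℓ = 0 then (1 : ℤ) else -1) * c ℓ = (∑ ℓ, (if κ ℓ = 0 then (1 : ℤ) else -1)) * c ℓ₀ := by
          rw [Finset.sum_mul]; exact Finset.sum_congr rfl fun ℓ _ => by rw [hconst ℓ]
      _ = c ℓ₀ := by rw [hsgn, one_mul]
  rw [hKW']
  by_cases hzero : c ℓ₀ = 0
  · exact Or.inl hzero
  right
  -- `c = ±1`: every pair carries exactly one letter
  have hN : ∀ ℓ, (Finset.univ.filter fun t => P t = Sum.inl ℓ).card = 1 := by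
    intro ℓ
    have h := hcℓ ℓ
    rw [hconst ℓ] at h
    have h0 := hcℓ ℓ₀
    have hA := hn1 ℓ; have hB := hn2 ℓ; have hA₀ := hn1 ℓ₀; have hB₀ := hn2 ℓ₀
    rw [hNℓ ℓ]
    omega
  -- count the `T`-positions pair by pair
  rw [Fintype.card_subtype, Finset.card_eq_sum_card_fiberwise (f := fun t => Sum.elim id (fun _ => ℓ₀) (P t))
    (t := Finset.univ) (fun _ _ => Finset.mem_univ _)]
  have hfib : ∀ b : Fin hY, ((Finset.univ.filter fun t => (P t).isLeft = true).filter
      fun a => Sum.elim id (fun _ => ℓ₀) (P a) = b) = Finset.univ.filter fun t => P t = Sum.inl b := by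
    intro b
    rw [Finset.filter_filter]
    refine Finset.filter_congr fun t _ => ?_
    rcases P t with ℓ | e
    · simp only [Sum.isLeft_inl, Sum.elim_inl, id_eq, true_and, Sum.inl.injEq]
    · simp only [Sum.isLeft_inr, Bool.false_eq_true, Sum.elim_inr, false_and, reduceCtorEq]
  simp only [hfib, hN, Finset.sum_const, Finset.card_univ, Fintype.card_fin, smul_eq_mul, mul_one]

end Combinatorics

/-! ### §2 The skew Hodge-commutant of `H¹(E × E)` is abelian: corners through a presentation, and the centralizer of `χ^*` in rank two -/

section Commutant

/-- **Commutant of the matrix units of a presentation `U = ι₁W ⊕ ι₂W`.** If `Z ∈ End(U)` commutes with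
`ι₁π₁`, `ι₂π₂`, `ι₂π₁` and with `ι₁xπ₁` for the `x` of a set `C ⊆ End(W)`, then `Z = ι₁zπ₁ + ι₂zπ₂` with
`z = π₁Zι₁` commuting with `C`; hence two such `Z, Z'` commute as soon as the commutant of `C` in `End(W)` is
commutative (`M₂(R)' = R' · 1₂`). [folklore] [cite: MoonenZarhin1999LowDim, §5 (5.12) («`Hg(X) ≅ Hg(X₁ × X₂)`»)] -/
theorem mul_comm_of_commute_cornerUnits {K U W : Type*} [Field K] [AddCommGroup U] [Module K U] [AddCommGroup W]
    [Module K W] {ι₁ ι₂ : W →ₗ[K] U} {π₁ π₂ : U →ₗ[K] W}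
    (h11 : π₁ ∘ₗ ι₁ = LinearMap.id) (h22 : π₂ ∘ₗ ι₂ = LinearMap.id) (h12 : π₁ ∘ₗ ι₂ = 0) (h21 : π₂ ∘ₗ ι₁ = 0)
    (hsum : ι₁ ∘ₗ π₁ + ι₂ ∘ₗ π₂ = LinearMap.id) (C : Set (Module.End K W))
    (hC : ∀ z z' : Module.End K W, (∀ x ∈ C, z * x = x * z) → (∀ x ∈ C, z' * x = x * z') → z * z' = z' * z)
    {Z Z' : Module.End K U}
    (hZ₁ : Z * (ι₁ ∘ₗ π₁) = (ι₁ ∘ₗ π₁) * Z) (hZ₂ : Z * (ι₂ ∘ₗ π₂) = (ι₂ ∘ₗ π₂) * Z)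
    (hZ₂₁ : Z * (ι₂ ∘ₗ π₁) = (ι₂ ∘ₗ π₁) * Z) (hZC : ∀ x ∈ C, Z * (ι₁ ∘ₗ x ∘ₗ π₁) = (ι₁ ∘ₗ x ∘ₗ π₁) * Z)
    (hZ'₁ : Z' * (ι₁ ∘ₗ π₁) = (ι₁ ∘ₗ π₁) * Z') (hZ'₂ : Z' * (ι₂ ∘ₗ π₂) = (ι₂ ∘ₗ π₂) * Z')
    (hZ'₂₁ : Z' * (ι₂ ∘ₗ π₁) = (ι₂ ∘ₗ π₁) * Z') (hZ'C : ∀ x ∈ C, Z' * (ι₁ ∘ₗ x ∘ₗ π₁) = (ι₁ ∘ₗ x ∘ₗ π₁) * Z') :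
    Z * Z' = Z' * Z := by
  have e11 : ∀ v, π₁ (ι₁ v) = v := fun v => by
    rw [← LinearMap.comp_apply (f := π₁), h11, LinearMap.id_apply]
  have e22 : ∀ w, π₂ (ι₂ w) = w := fun w => by
    rw [← LinearMap.comp_apply (f := π₂), h22, LinearMap.id_apply]
  have e12 : ∀ w, π₁ (ι₂ w) = 0 := fun w => by
    rw [← LinearMap.comp_apply (f := π₁), h12, LinearMap.zero_apply]
  have e21 : ∀ v, π₂ (ι₁ v) = 0 := fun v => by
    rw [← LinearMap.comp_apply (f := π₂), h21, LinearMap.zero_apply]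
  have esum : ∀ u, ι₁ (π₁ u) + ι₂ (π₂ u) = u := fun u => by
    have h := LinearMap.congr_fun hsum u
    simpa only [LinearMap.add_apply, LinearMap.comp_apply, LinearMap.id_apply] using h
  -- the block form `X = ι₁xπ₁ + ι₂xπ₂`, `x = π₁Xι₁` commuting with `C`, of any `X` with the three commutations
  have hblock : ∀ X : Module.End K U, X * (ι₁ ∘ₗ π₁) = (ι₁ ∘ₗ π₁) * X → X * (ι₂ ∘ₗ π₂) = (ι₂ ∘ₗ π₂) * X →
      X * (ι₂ ∘ₗ π₁) = (ι₂ ∘ₗ π₁) * X → (∀ x ∈ C, X * (ι₁ ∘ₗ x ∘ₗ π₁) = (ι₁ ∘ₗ x ∘ₗ π₁) * X) →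
      (∀ u, X u = ι₁ (π₁ (X (ι₁ (π₁ u)))) + ι₂ (π₁ (X (ι₁ (π₂ u))))) ∧
        ∀ x ∈ C, (π₁ ∘ₗ X ∘ₗ ι₁) * x = x * (π₁ ∘ₗ X ∘ₗ ι₁) := by
    intro X hX₁ hX₂ hX₂₁ hXC
    have hXι₁ : ∀ w, X (ι₁ w) = ι₁ (π₁ (X (ι₁ w))) := fun w => by
      have h := congrArg (fun f : Module.End K U => f (ι₁ w)) hX₁
      simp only [Module.End.mul_apply, LinearMap.comp_apply, e11] at h
      exact h
    have hXι₂ : ∀ w, X (ι₂ w) = ι₂ (π₁ (X (ι₁ w))) := fun w => by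
      have h := congrArg (fun f : Module.End K U => f (ι₁ w)) hX₂₁
      simp only [Module.End.mul_apply, LinearMap.comp_apply, e11] at h
      exact h
    refine ⟨fun u => ?_, fun x hx => ?_⟩
    · conv_lhs => rw [← esum u]
      rw [map_add, hXι₁ (π₁ u), hXι₂ (π₂ u), e11]
    · apply LinearMap.ext
      intro w
      have h := congrArg (fun f : Module.End K U => π₁ (f (ι₁ w))) (hXC x hx)
      simp only [Module.End.mul_apply, LinearMap.comp_apply, e11] at h
      simp only [Module.End.mul_apply, LinearMap.comp_apply]
      rw [hXι₁ (x w), e11] at h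
      exact h
  obtain ⟨hZu, hzC⟩ := hblock Z hZ₁ hZ₂ hZ₂₁ hZC
  obtain ⟨hZ'u, hz'C⟩ := hblock Z' hZ'₁ hZ'₂ hZ'₂₁ hZ'C
  have hzz := hC _ _ hzC hz'C
  have hzz' : ∀ w, π₁ (Z (ι₁ (π₁ (Z' (ι₁ w))))) = π₁ (Z' (ι₁ (π₁ (Z (ι₁ w))))) := fun w => by
    have h := congrArg (fun f : Module.End K W => f w) hzz
    simpa only [Module.End.mul_apply, LinearMap.comp_apply] using h
  apply LinearMap.ext
  intro u
  rw [Module.End.mul_apply, Module.End.mul_apply, hZu (Z' u), hZ'u u, hZ'u (Z u), hZu u]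
  simp only [map_add, e11, e12, e21, e22, add_zero, zero_add, hzz']

/-- **The centralizer of `χ` with `χ² = -d`, `d > 0`, on a rational PLANE is commutative** (it is `ℚ + ℚχ`: `χ` has
no rational eigenvector, so `(v, χv)` is a basis and `z = x + yχ` is read off `zv = xv + yχv`). The `H¹` of an
elliptic curve with complex multiplication: `End_k(H¹(E; ℚ)) = k`. [folklore] [cite: MoonenZarhin1999LowDim, §2 (2.1)] -/
theorem mul_comm_of_commute_of_mul_self_eq_neg {W : Type*} [AddCommGroup W] [Module ℚ W]
    (hW : Module.finrank ℚ W = 2) {χ : Module.End ℚ W} {d : ℚ} (hd : 0 < d) (hχ : χ * χ = -(d • 1))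
    {z z' : Module.End ℚ W} (hz : z * χ = χ * z) (hz' : z' * χ = χ * z') : z * z' = z' * z := by
  classical
  haveI : Module.Finite ℚ W := Module.finite_of_finrank_eq_succ hW
  haveI : Nontrivial W := Module.nontrivial_of_finrank_pos (R := ℚ) (by rw [hW]; norm_num)
  obtain ⟨v, hv⟩ := exists_ne (0 : W)
  have hχχ : ∀ w, χ (χ w) = -(d • w) := fun w => by
    rw [← Module.End.mul_apply, hχ, LinearMap.neg_apply, LinearMap.smul_apply, Module.End.one_apply]
  -- `(v, χ v)` is a basis
  have hli : LinearIndependent ℚ ![v, χ v] := by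
    refine LinearIndependent.pair_iff.2 fun s t hst => ?_
    have h2 : s • χ v + t • χ (χ v) = 0 := by
      have h := congrArg χ hst
      rwa [map_add, map_smul, map_smul, map_zero] at h
    rw [hχχ, smul_neg, ← sub_eq_add_neg, smul_smul] at h2
    -- `s · (first) - t · (second)`: `(s² + t² d) v = 0`
    have h3 : (s * s + t * t * d) • v = 0 := by
      have e : (s * s + t * t * d) • v = s • (s • v + t • χ v) - t • (s • χ v - (t * d) • v) := by module
      rw [e, hst, h2, smul_zero, smul_zero, sub_zero]
    have hcoef : s * s + t * t * d = 0 := by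
      by_contra hne
      exact hv (smul_eq_zero.1 h3 |>.resolve_left hne)
    have hs : s = 0 := by nlinarith [mul_self_nonneg s, mul_self_nonneg t]
    have ht : t * t = 0 := by nlinarith [mul_self_nonneg s, mul_self_nonneg t]
    exact ⟨hs, mul_self_eq_zero.1 ht⟩
  have hcard : Fintype.card (Fin 2) = Module.finrank ℚ W := by rw [Fintype.card_fin, hW]
  set b : Module.Basis (Fin 2) ℚ W := basisOfLinearIndependentOfCardEqFinrank hli hcard with hbdef
  have hb0 : b 0 = v := by rw [hbdef, coe_basisOfLinearIndependentOfCardEqFinrank]; rfl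
  have hb1 : b 1 = χ v := by rw [hbdef, coe_basisOfLinearIndependentOfCardEqFinrank]; rfl
  -- `z = x + yχ`
  have hexp : ∀ y : Module.End ℚ W, y * χ = χ * y → ∃ s t : ℚ, y = s • 1 + t • χ := by
    intro y hy
    obtain ⟨s, hs⟩ : ∃ s : ℚ, b.repr (y v) 0 = s := ⟨_, rfl⟩
    obtain ⟨t, ht⟩ : ∃ t : ℚ, b.repr (y v) 1 = t := ⟨_, rfl⟩
    have hyv : y v = s • v + t • χ v := by
      conv_lhs => rw [← b.sum_repr (y v)]
      rw [Fin.sum_univ_two, hb0, hb1, hs, ht]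
    have key0 : y v = (s • (1 : Module.End ℚ W) + t • χ) v := by
      rw [LinearMap.add_apply, LinearMap.smul_apply, LinearMap.smul_apply, Module.End.one_apply]
      exact hyv
    have key1 : y (χ v) = (s • (1 : Module.End ℚ W) + t • χ) (χ v) := by
      have e : y (χ v) = χ (y v) := by
        change (y * χ) v = (χ * y) v
        rw [hy]
      rw [e, hyv, map_add, map_smul, map_smul, LinearMap.add_apply, LinearMap.smul_apply, LinearMap.smul_apply,
        Module.End.one_apply]
    refine ⟨s, t, b.ext fun i => ?_⟩
    rcases fin2_eq_zero_or_one_sq i with rfl | rfl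
    · rw [hb0]; exact key0
    · rw [hb1]; exact key1
  obtain ⟨s, t, hzst⟩ := hexp z hz
  rw [hzst, add_mul, mul_add, smul_mul_assoc, smul_mul_assoc, mul_smul_comm, mul_smul_comm, one_mul, mul_one, ← hz']

variable {E : AbelianVariety ℂ}

/-- `(f ≫ g)^* = f^* ∘ g^*` on `H¹` (a copy of the private lemma of `HOneOfProductEndomorphismBlocks`). [folklore] -/
private theorem pull_comp_sq {X Y Z : AbelianVariety ℂ} (f : X ⟶ Y) (g : Y ⟶ Z) :
    BettiUniverse.pull (f ≫ g).hom.hom.hom 1 =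
      BettiUniverse.pull f.hom.hom.hom 1 ∘ₗ BettiUniverse.pull g.hom.hom.hom 1 := by
  change (bettiCohomology.map (f ≫ g).hom.hom.hom 1).hom = _
  rw [bettiCohomology_map_comp_hom, ModuleCat.hom_comp]

/-- **The Hodge-commutant of `H¹(E × E; ℚ)` is abelian for an elliptic curve `E` with complex multiplication**
(`χ ≫ χ = -d'`, `d' > 0`): any two rational endomorphisms of `H¹((E × E)(ℂ); ℚ)` commuting with every element of
`End_Hdg(H¹(E × E))` — in particular with the pull-backs of `pr_a ≫ ι_b` and of `pr₁ ≫ χ ≫ ι₁` — commute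
(`End_Hdg ⊇ M₂(ℚ(χ^*))`, whose commutant is `ℚ(χ^*)`; «`Hg(X₁²) ≅ Hg(X₁) = U_k(1)` is a torus»).
[cite: MoonenZarhin1999LowDim, §5 (5.12) and §3 Lemma (3.6)] [cite: Lange2023AbelianVarietiesC, Cor. 2.4.26] -/
theorem HOneProduct.mul_comm_of_commute_endAlg_cmCurve_prod_self (hE1 : E.dim = 1) (χ : E ⟶ E) {d' : ℕ}
    (hd' : 0 < d') (hχ : χ ≫ χ = -(d' • 𝟙 E)) {Z Z' : Module.End ℚ (bettiCohomology (E.prod E).X 1)}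
    (hZ : ∀ b : ↥(BettiUniverse.hodge exists_isReal_hodgeModel_holds
      (AbelianVariety.isSmoothProjective_holds (A := E.prod E)) 1).endAlg,
      Z * (b : Module.End ℚ (bettiCohomology (E.prod E).X 1)) = (b : Module.End ℚ _) * Z)
    (hZ' : ∀ b : ↥(BettiUniverse.hodge exists_isReal_hodgeModel_holds
      (AbelianVariety.isSmoothProjective_holds (A := E.prod E)) 1).endAlg,
      Z' * (b : Module.End ℚ (bettiCohomology (E.prod E).X 1)) = (b : Module.End ℚ _) * Z') :
    Z * Z' = Z' * Z := by
  have hHD : exists_isReal_hodgeModel := exists_isReal_hodgeModel_holds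
  have hI : hodgePQ_independent_of_hodgeModel := hodgePQ_independent_of_hodgeModel_holds
  haveI : Module.Finite ℚ (bettiCohomology E.X 1) := finite_bettiCohomology_one E
  set χQ : Module.End ℚ (bettiCohomology E.X 1) := (bettiCohomology.map χ.hom.hom.hom 1).hom with hχQ
  have hχ2 : χQ * χQ = -((d' : ℚ) • 1) := bettiMapHom_mul_self hχ
  have hW : Module.finrank ℚ (bettiCohomology E.X 1) = 2 := by rw [finrank_bettiCohomology_one E, hE1]
  -- the units `(pr_a ≫ ι_b)^*` and `(pr₁ ≫ χ ≫ ι₁)^*` are Hodge endomorphisms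
  have hunit : ∀ f : E.prod E ⟶ E.prod E, ∀ X : Module.End ℚ (bettiCohomology (E.prod E).X 1),
      (∀ b : ↥(BettiUniverse.hodge hHD (AbelianVariety.isSmoothProjective_holds (A := E.prod E)) 1).endAlg,
        X * (b : Module.End ℚ _) = (b : Module.End ℚ _) * X) →
      X * BettiUniverse.pull f.hom.hom.hom 1 = BettiUniverse.pull f.hom.hom.hom 1 * X :=
    fun f X hX => hX ⟨BettiUniverse.pull f.hom.hom.hom 1, pullback_mem_endAlg hHD hI f⟩
  have h11 : HOneProduct.pullFst E E ∘ₗ HOneProduct.pullInl E E =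
      BettiUniverse.pull (AbelianVariety.fst E E ≫ HOneProduct.inlHom E E).hom.hom.hom 1 := (pull_comp_sq _ _).symm
  have h22 : HOneProduct.pullSnd E E ∘ₗ HOneProduct.pullInr E E =
      BettiUniverse.pull (AbelianVariety.snd E E ≫ HOneProduct.inrHom E E).hom.hom.hom 1 := (pull_comp_sq _ _).symm
  have h21 : HOneProduct.pullSnd E E ∘ₗ HOneProduct.pullInl E E =
      BettiUniverse.pull (AbelianVariety.snd E E ≫ HOneProduct.inlHom E E).hom.hom.hom 1 := (pull_comp_sq _ _).symm
  have hχu : HOneProduct.pullFst E E ∘ₗ χQ ∘ₗ HOneProduct.pullInl E E =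
      BettiUniverse.pull (AbelianVariety.fst E E ≫ χ ≫ HOneProduct.inlHom E E).hom.hom.hom 1 := by
    rw [pull_comp_sq, pull_comp_sq]
  refine mul_comm_of_commute_cornerUnits (K := ℚ) HOneProduct.pullInl_comp_pullFst HOneProduct.pullInr_comp_pullSnd
    HOneProduct.pullInl_comp_pullSnd HOneProduct.pullInr_comp_pullFst HOneProduct.pullFst_comp_pullInl_add {χQ}
    (fun z z' hz hz' => mul_comm_of_commute_of_mul_self_eq_neg hW (Nat.cast_pos.2 hd') hχ2 (hz χQ rfl) (hz' χQ rfl))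
    ?_ ?_ ?_ (fun x hx => ?_) ?_ ?_ ?_ (fun x hx => ?_)
  · rw [h11]; exact hunit _ Z hZ
  · rw [h22]; exact hunit _ Z hZ
  · rw [h21]; exact hunit _ Z hZ
  · rw [Set.mem_singleton_iff.1 hx, hχu]; exact hunit _ Z hZ
  · rw [h11]; exact hunit _ Z' hZ'
  · rw [h22]; exact hunit _ Z' hZ'
  · rw [h21]; exact hunit _ Z' hZ'
  · rw [Set.mem_singleton_iff.1 hx, hχu]; exact hunit _ Z' hZ'

end Commutant

/-! ### §3 The invariance theorem for ONE slot over `T × S`, multiplicities `(2,1)`, `S` with abelian skew Hodge-commutant -/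

section Invariance

variable {Y S X : AbelianVariety ℂ} {g : Fin 1 → (X ⟶ Y.prod S)}

/-- `(i√d)² = -d` (as the rational `d` cast to `ℂ`). [folklore] -/
private theorem I_mul_sqrt_sq_sq (d : ℕ) : (Complex.I * (Real.sqrt d : ℂ)) ^ 2 = -((d : ℚ) : ℂ) := by
  rw [mul_pow, Complex.I_sq, ← Complex.ofReal_pow, Real.sq_sqrt (Nat.cast_nonneg d), Complex.ofReal_natCast,
    Rat.cast_natCast, neg_one_mul]

/-- `conj(i√d) = -i√d`. [folklore] -/
private theorem conj_I_mul_sqrt_sq (d : ℕ) :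
    starRingEnd ℂ (Complex.I * (Real.sqrt d : ℂ)) = -(Complex.I * (Real.sqrt d : ℂ)) := by
  rw [map_mul, Complex.conj_I, Complex.conj_ofReal, neg_mul]

/-- `[a]·x - [b]·x = ([a] - [b]) • x` with an integer scalar. [folklore] -/
private theorem ite_sub_ite_eq_cast_smul_sq {M : Type*} [AddCommGroup M] [Module ℂ M] (a b : Prop) [Decidable a]
    [Decidable b] (x : M) :
    ((if a then x else 0) - (if b then x else 0)) =
      ((((if a then (1 : ℤ) else 0) - (if b then (1 : ℤ) else 0) : ℤ)) : ℂ) • x := by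
  split_ifs <;> simp

set_option maxHeartbeats 800000 in
open scoped Classical in
/-- **The INVARIANCE THEOREM for ONE slot over `T × S`, `T` a threefold of unitary type `(2,1)` over
`End⁰(T) = ℚ(√-d)`, `S` ANY complex abelian variety whose `H¹` has an ABELIAN skew Hodge-commutant** (hypothesis `hSc`:
any two `ψ`-skew rational endomorphisms of `H¹(S(ℂ); ℚ)` commuting with `End_Hdg(H¹ S)` commute — `S` an elliptic
curve with complex multiplication, its square `E × E` (`HOneProduct.mul_comm_of_commute_endAlg_cmCurve_prod_self`),
any abelian variety of CM type). Moonen–Zarhin 1999 case (e) with (a1), §5 (5.12): «our description of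
`Hg(X) ≅ Hg(X₁ × X₂)` in (5.3) above shows that `Hg(X) ⊃ {1} × SU_{F/k}(V₂,ψ)`» — in Lie form: the annihilator of a
Hodge class contains `ι_T 𝔰𝔲_k(H¹T, ψ) π_T` (the tree's R41 Lie step
`Motives/HodgeThetaAnnihilatorUnitaryTimesAbelianCommutant`). Let `T` (here `Y`) be a complex abelian threefold with
`dim_ℚ End⁰(T) = 2`, `φ ≫ φ = -d` (`d > 0`) of multiplicity `1` at `i√d` or at `-i√d`; `X` with ONE slot over `T × S`.
Then there are Hodge-adapted pair bases of `H¹(T) ⊗ ℂ` and `H¹(S) ⊗ ℂ` such that every rational `(p,p)`-class on `X`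
has a letter expansion whose coefficient function VANISHES at every word which is not kind-balanced, or has a
repeated letter, or is neither `T`-kind balanced NOR carries exactly one letter from each of the `dim T` pairs of
`H¹(T)` (so that its number of `T`-positions is `dim T = 3`). Proof: R30's proof (`UnitaryTwoOneTimesCMCurveWeilClasses` §2) verbatim up to the
root-difference weights — the Lie step now fed with `hSc` — then `kindWeight_eq_zero_or_card_isLeft_eq_of_rootDiffWeights`.
[cite: MoonenZarhin1999LowDim, Thm. 0.2 (1) with case (e) and §5 (5.3), (5.12)] [cite: MoonenZarhin1999LowDim, §2 (2.3) and §3 (3.1)]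
[cite: Deligne1982HodgeCycles, I §3 Prop. 3.4] [cite: Lombardo2016, Lemma 3.4 (p. 1229)] [cite: Ribet1983, Thm. 3] -/
theorem AVSlots.exists_coeff_eq_zero_off_balanced_or_onePerPair_of_prod_unitaryTwoOne_abelianCommutant
    (hg : AVSlots (Y.prod S) X g)
    (hY3 : Y.dim = 3) (hY2 : Module.finrank ℚ Y.endAlgebra = 2) (φY : Y ⟶ Y) {d : ℕ} (hd : 0 < d)
    (hφY : φY ≫ φY = -(d • 𝟙 Y))
    (hm1 : eigenMultiplicity Y φY (Complex.I * (Real.sqrt d : ℂ)) = 1 ∨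
      eigenMultiplicity Y φY (-(Complex.I * (Real.sqrt d : ℂ))) = 1)
    (hSc : ∀ (ψ₂ : (BettiUniverse.hodge exists_isReal_hodgeModel_holds
        (AbelianVariety.isSmoothProjective_holds (A := S)) 1).Polarization)
      (Z Z' : Module.End ℚ (bettiCohomology S.X 1)),
      (∀ b : ↥(BettiUniverse.hodge exists_isReal_hodgeModel_holds
        (AbelianVariety.isSmoothProjective_holds (A := S)) 1).endAlg,
        Z * (b : Module.End ℚ (bettiCohomology S.X 1)) = (b : Module.End ℚ (bettiCohomology S.X 1)) * Z) →
      (∀ v w, ψ₂.form (Z v) w + ψ₂.form v (Z w) = 0) →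
      (∀ b : ↥(BettiUniverse.hodge exists_isReal_hodgeModel_holds
        (AbelianVariety.isSmoothProjective_holds (A := S)) 1).endAlg,
        Z' * (b : Module.End ℚ (bettiCohomology S.X 1)) = (b : Module.End ℚ (bettiCohomology S.X 1)) * Z') →
      (∀ v w, ψ₂.form (Z' v) w + ψ₂.form v (Z' w) = 0) → Z * Z' = Z' * Z) :
    ∃ (hA : ℕ) (bA : Module.Basis (Fin hA × Fin 2) ℂ (ℂ ⊗[ℚ] bettiCohomology Y.X 1))
      (h : ℕ) (cC : Module.Basis (Fin h × Fin 2) ℂ (ℂ ⊗[ℚ] bettiCohomology S.X 1)),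
      (∀ i, IsOfHodgeType Y.dim Y.X 1 1 0 (ofRatClassBaseChange (Motives.ComplexPoints Y.X) 1 (bA (i, 0)))) ∧
      (∀ i, IsOfHodgeType Y.dim Y.X 1 0 1 (ofRatClassBaseChange (Motives.ComplexPoints Y.X) 1 (bA (i, 1)))) ∧
      (∀ i, IsOfHodgeType S.dim S.X 1 1 0 (ofRatClassBaseChange (Motives.ComplexPoints S.X) 1 (cC (i, 0)))) ∧
      (∀ i, IsOfHodgeType S.dim S.X 1 0 1 (ofRatClassBaseChange (Motives.ComplexPoints S.X) 1 (cC (i, 1)))) ∧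
      ∀ {p : ℕ}, 0 < p → ∀ {c : complexBetti X.X (2 * p)}, IsRationalClass c →
        IsOfHodgeType X.dim X.X (2 * p) p p c →
        ∃ a : (Fin (2 * p) → (Fin 1 × (Fin hA ⊕ Fin h)) × Fin 2) → ℂ,
          wordEval (cupPowOneAlt ℂ (Motives.ComplexPoints X.X) (2 * p))
            (fun jr : (Fin 1 × (Fin hA ⊕ Fin h)) × Fin 2 => complexBetti.map (g jr.1.1).hom.hom.hom 1
              (Sum.elim
                (fun i => complexBetti.map (Motives.AbelianVariety.fst Y S).hom.hom.hom 1
                  (ofRatClassBaseChange (Motives.ComplexPoints Y.X) 1 (bA (i, jr.2))))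
                (fun i => complexBetti.map (Motives.AbelianVariety.snd Y S).hom.hom.hom 1
                  (ofRatClassBaseChange (Motives.ComplexPoints S.X) 1 (cC (i, jr.2))))
                jr.1.2)) a = c ∧
          ∀ (U : Fin (2 * p) → Fin 1 × (Fin hA ⊕ Fin h)) (η : Fin (2 * p) → Fin 2),
            a (fun t => (U t, η t)) ≠ 0 →
            (∀ r : Fin 2, (Finset.univ.filter fun t => η t = r).card = p) ∧
            Function.Injective (fun t => ((U t).2, η t)) ∧
            ((∑ t, Sum.elim (fun _ : Fin hA => if η t = 0 then (1 : ℤ) else -1) (fun _ : Fin h => (0 : ℤ)) (U t).2 = 0) ∨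
             Fintype.card {t // ((U t).2).isLeft = true} = hA) := by
  classical
  -- the setting
  have hHD : exists_isReal_hodgeModel := exists_isReal_hodgeModel_holds
  have hI : hodgePQ_independent_of_hodgeModel := hodgePQ_independent_of_hodgeModel_holds
  haveI : HodgeTensorFacts.{0, 0} := hodgeTensorFacts_holds.{0, 0}
  have hXA : IsSmoothProjective Y.dim Y.X := AbelianVariety.isSmoothProjective_holds
  have hXC : IsSmoothProjective S.dim S.X := AbelianVariety.isSmoothProjective_holds
  have hXP : IsSmoothProjective (Y.prod S).dim (Y.prod S).X := AbelianVariety.isSmoothProjective_holds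
  haveI : Module.Finite ℚ (bettiCohomology Y.X 1) := finite_bettiCohomology_one Y
  haveI : Module.Finite ℚ (bettiCohomology S.X 1) := finite_bettiCohomology_one S
  haveI : Module.Finite ℚ (bettiCohomology (Y.prod S).X 1) := finite_bettiCohomology_one (Y.prod S)
  have hn1 : (((1 : ℕ) : ℤ)) = 1 := by norm_num
  have heffA := BettiUniverse.hodge_isEffective hHD hXA 1
  -- polarizations of `H¹(Y)`, `H¹(S)`
  obtain ⟨ψ⟩ : (BettiUniverse.hodge hHD (AbelianVariety.isSmoothProjective_holds (A := Y)) 1).IsPolarizable :=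
    smoothProjective_hodgeStructure_isPolarizable_holds hXA (BettiUniverse.realHodgeModel hHD hXA)
      (BettiUniverse.realHodgeModel_isHodgeSymmetric hHD hXA) 1
  obtain ⟨ψC⟩ : (BettiUniverse.hodge hHD (AbelianVariety.isSmoothProjective_holds (A := S)) 1).IsPolarizable :=
    smoothProjective_hodgeStructure_isPolarizable_holds hXC (BettiUniverse.realHodgeModel hHD hXC)
      (BettiUniverse.realHodgeModel_isHodgeSymmetric hHD hXC) 1
  -- the unitary data of `H¹(Y)`: `φ^*`, `End_Hdg = ℚ + ℚφ^*`, `μ` with `n''(μ) = 1`, `n'(μ) ≥ 2`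
  set φQ : Module.End ℚ (bettiCohomology Y.X 1) := (bettiCohomology.map φY.hom.hom.hom 1).hom with hφQ
  have hφE : φQ ∈ (BettiUniverse.hodge hHD (AbelianVariety.isSmoothProjective_holds (A := Y)) 1).endAlg :=
    pullback_mem_endAlg hHD hI φY
  have hφ2 : φQ * φQ = -((d : ℚ) • 1) := bettiMapHom_mul_self hφY
  have hdQ : (0 : ℚ) < d := Nat.cast_pos.2 hd
  have hE := exists_eq_smul_one_add_smul_bettiMapHom hHD hI hd hφY hY2 (by omega)
  have hsumm := eigenMultiplicity_add_eigenMultiplicity_neg_eq_dim Y φY hd hφY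
  -- `μ` with multiplicity `1` on `H^{0,1}` and `2` on `H^{1,0}`
  obtain ⟨μ, hμ, hmult1, hmult2'⟩ : ∃ μ : ℂ, μ ^ 2 = -((d : ℚ) : ℂ) ∧
      eigenMultiplicity Y φY (starRingEnd ℂ μ) = 1 ∧ eigenMultiplicity Y φY μ = 2 := by
    rcases hm1 with h | h
    · exact ⟨-(Complex.I * (Real.sqrt d : ℂ)), by rw [neg_sq, I_mul_sqrt_sq_sq],
        by rw [map_neg, conj_I_mul_sqrt_sq, neg_neg, h], by omega⟩
    · exact ⟨Complex.I * (Real.sqrt d : ℂ), I_mul_sqrt_sq_sq d, by rw [conj_I_mul_sqrt_sq, h], by omega⟩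
  have hmult2 : 2 ≤ eigenMultiplicity Y φY μ := hmult2'.ge
  have h1' : Module.finrank ℂ ↥(Module.End.eigenspace (φQ.baseChange ℂ) μ ⊓
      (BettiUniverse.hodge hHD (AbelianVariety.isSmoothProjective_holds (A := Y)) 1).piece 0 1) = 1 := by
    rw [hφQ, finrank_eigenspace_inf_piece_zeroOne_eq_eigenMultiplicity_conj hHD hI φY μ, hmult1]
  have h2' : 2 ≤ Module.finrank ℂ ↥(Module.End.eigenspace (φQ.baseChange ℂ) μ ⊓
      (BettiUniverse.hodge hHD (AbelianVariety.isSmoothProjective_holds (A := Y)) 1).piece 1 0) := by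
    rw [hφQ, finrank_eigenspace_inf_piece_oneZero_eq_eigenMultiplicity hHD hI φY μ]
    exact hmult2
  have h2eq : Module.finrank ℂ ↥(Module.End.eigenspace (φQ.baseChange ℂ) μ ⊓
      (BettiUniverse.hodge hHD (AbelianVariety.isSmoothProjective_holds (A := Y)) 1).piece 1 0) = 2 := by
    rw [hφQ, finrank_eigenspace_inf_piece_oneZero_eq_eigenMultiplicity hHD hI φY μ, hmult2']
  obtain ⟨hμ0, -⟩ := UnitaryTheta.conj_eq_neg_of_sq hdQ hμ
  -- adapted `ψ_ℂ`-dual bases `(e_ℓ, f_ℓ) = (cb (0,ℓ), cb (1,ℓ))` of `H¹(Y) ⊗ ℂ = W ⊕ W'`, kinds `κ`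
  obtain ⟨n₀, cb, κ, hcbW, hcbW', hcb0, hcb1, hdual⟩ := UnitaryTheta.exists_adaptedDualBasis
    (BettiUniverse.hodge hHD (AbelianVariety.isSmoothProjective_holds (A := Y)) 1) Nat.cast_one heffA ψ hφE
    hdQ hφ2 hE hμ
  -- the same basis in PAIR format: `bY (ℓ, r) = cb (if r = κ ℓ then 0 else 1, ℓ)` (`r` = the Hodge kind)
  set τ : Fin n₀ × Fin 2 ≃ Fin 2 × Fin n₀ :=
    { toFun := fun lr => (if lr.2 = κ lr.1 then 0 else 1, lr.1)
      invFun := fun tl => (tl.2, if tl.1 = 0 then κ tl.2 else (if κ tl.2 = 0 then 1 else 0))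
      left_inv := by
        rintro ⟨ℓ, r⟩
        rcases fin2_eq_zero_or_one_sq r with hr | hr <;>
          rcases fin2_eq_zero_or_one_sq (κ ℓ) with hk | hk <;> simp [hr, hk]
      right_inv := by
        rintro ⟨t, ℓ⟩
        rcases fin2_eq_zero_or_one_sq t with ht | ht <;>
          rcases fin2_eq_zero_or_one_sq (κ ℓ) with hk | hk <;> simp [ht, hk] } with hτ
  set bY : Module.Basis (Fin n₀ × Fin 2) ℂ (ℂ ⊗[ℚ] bettiCohomology Y.X 1) := cb.reindex τ.symm with hbYdef
  have hbY : ∀ ℓ r, bY (ℓ, r) = cb (if r = κ ℓ then 0 else 1, ℓ) := fun ℓ r => by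
    rw [hbYdef, Module.Basis.reindex_apply, Equiv.symm_symm]
    rfl
  have hbY0' : ∀ ℓ, bY (ℓ, 0) ∈ (BettiUniverse.hodge hHD hXA 1).piece 1 0 := by
    intro ℓ
    rw [hbY]
    rcases fin2_eq_zero_or_one_sq (κ ℓ) with hk | hk
    · rw [hk, if_pos rfl]; exact (hcb0 ℓ hk).1
    · rw [hk, if_neg (by decide)]; exact (hcb1 ℓ hk).2
  have hbY1' : ∀ ℓ, bY (ℓ, 1) ∈ (BettiUniverse.hodge hHD hXA 1).piece 0 1 := by
    intro ℓ
    rw [hbY]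
    rcases fin2_eq_zero_or_one_sq (κ ℓ) with hk | hk
    · rw [hk, if_neg (by decide)]; exact (hcb0 ℓ hk).2
    · rw [hk, if_pos rfl]; exact (hcb1 ℓ hk).1
  -- the pair basis of `H¹(S) ⊗ ℂ`
  obtain ⟨h, cC, hcC0, hcC1⟩ := exists_hodgeAdapted_pairBasis (BettiUniverse.hodge hHD hXC 1) (by norm_num)
    (BettiUniverse.hodge_isEffective hHD hXC 1)
  have hcC0' : ∀ i, cC (i, 0) ∈ (BettiUniverse.hodge hHD hXC 1).piece 1 0 := fun i => by simpa using hcC0 i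
  have hcC1' : ∀ i, cC (i, 1) ∈ (BettiUniverse.hodge hHD hXC 1).piece 0 1 := fun i => by simpa using hcC1 i
  -- COUNTS: `n₀ = dim Y = 3`, `#{κ = 1} ≤ 1`, `#{κ = 0} ≤ 2`, hence `#{κ = 0} = #{κ = 1} + 1`
  have hn₀ : n₀ = Y.dim := by
    have hcard := Module.finrank_eq_card_basis cb
    rw [Module.finrank_baseChange, finrank_bettiCohomology_one Y, Fintype.card_prod, Fintype.card_fin,
      Fintype.card_fin] at hcard
    omega
  have hκ1 : (Finset.univ.filter fun ℓ => κ ℓ = 1).card ≤ 1 := by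
    set S₀ := Module.End.eigenspace (φQ.baseChange ℂ) μ ⊓
      (BettiUniverse.hodge hHD (AbelianVariety.isSmoothProjective_holds (A := Y)) 1).piece 0 1 with hS₀
    set f : {ℓ : Fin n₀ // κ ℓ = 1} → ↥S₀ := fun ℓ => ⟨cb (0, ℓ.1), hcbW ℓ.1, (hcb1 ℓ.1 ℓ.2).1⟩ with hf
    have hli : LinearIndependent ℂ f := by
      refine LinearIndependent.of_comp S₀.subtype ?_
      have hcomp : ⇑S₀.subtype ∘ f = ⇑cb ∘ fun ℓ : {ℓ : Fin n₀ // κ ℓ = 1} => ((0 : Fin 2), ℓ.1) := by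
        funext ℓ; rfl
      rw [hcomp]
      exact cb.linearIndependent.comp _ fun ℓ ℓ' hll => Subtype.ext (Prod.mk.inj hll).2
    have hle := hli.fintype_card_le_finrank
    rw [Fintype.card_subtype, h1'] at hle
    exact hle
  have hκ0 : (Finset.univ.filter fun ℓ => κ ℓ = 0).card ≤ 2 := by
    set S₀ := Module.End.eigenspace (φQ.baseChange ℂ) μ ⊓
      (BettiUniverse.hodge hHD (AbelianVariety.isSmoothProjective_holds (A := Y)) 1).piece 1 0 with hS₀
    set f : {ℓ : Fin n₀ // κ ℓ = 0} → ↥S₀ := fun ℓ => ⟨cb (0, ℓ.1), hcbW ℓ.1, (hcb0 ℓ.1 ℓ.2).1⟩ with hf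
    have hli : LinearIndependent ℂ f := by
      refine LinearIndependent.of_comp S₀.subtype ?_
      have hcomp : ⇑S₀.subtype ∘ f = ⇑cb ∘ fun ℓ : {ℓ : Fin n₀ // κ ℓ = 0} => ((0 : Fin 2), ℓ.1) := by
        funext ℓ; rfl
      rw [hcomp]
      exact cb.linearIndependent.comp _ fun ℓ ℓ' hll => Subtype.ext (Prod.mk.inj hll).2
    have hle := hli.fintype_card_le_finrank
    rw [Fintype.card_subtype, h2eq] at hle
    exact hle
  have hκsum : (Finset.univ.filter fun ℓ => κ ℓ = 0).card + (Finset.univ.filter fun ℓ => κ ℓ = 1).card = n₀ := by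
    have hneg : (Finset.univ.filter fun ℓ => ¬ κ ℓ = 0) = (Finset.univ.filter fun ℓ => κ ℓ = 1) := by
      refine Finset.filter_congr fun ℓ _ => ?_
      rcases fin2_eq_zero_or_one_sq (κ ℓ) with hk | hk <;> simp [hk]
    rw [← hneg, Finset.card_filter_add_card_filter_not, Finset.card_univ, Fintype.card_fin]
  have hκ : (Finset.univ.filter fun ℓ => κ ℓ = 0).card = (Finset.univ.filter fun ℓ => κ ℓ = 1).card + 1 := by
    omega
  refine ⟨n₀, bY, h, cC, fun i => ?_, fun i => ?_, fun i => ?_, fun i => ?_, ?_⟩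
  · exact (BettiUniverse.mem_hodge_piece_iff hHD hI hXA (k := 1) (p := 1) (q := 0) rfl _).1 (hbY0' i)
  · exact (BettiUniverse.mem_hodge_piece_iff hHD hI hXA (k := 1) (p := 0) (q := 1) rfl _).1 (hbY1' i)
  · exact (BettiUniverse.mem_hodge_piece_iff hHD hI hXC (k := 1) (p := 1) (q := 0) rfl _).1 (hcC0' i)
  · exact (BettiUniverse.mem_hodge_piece_iff hHD hI hXC (k := 1) (p := 0) (q := 1) rfl _).1 (hcC1' i)
  intro p hp c hcQ hc
  -- the presentation `H¹(Y × S) = pr_Y^* H¹(Y) ⊕ pr_E^* H¹(S)` and its complexification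
  set ι₁ := HOneProduct.pullFst Y S with hι₁
  set π₁ := HOneProduct.pullInl Y S with hπ₁
  set ι₂ := HOneProduct.pullSnd Y S with hι₂
  set π₂ := HOneProduct.pullInr Y S with hπ₂
  have hπι₁ : π₁ ∘ₗ ι₁ = LinearMap.id := HOneProduct.pullInl_comp_pullFst
  have hπι₂ : π₂ ∘ₗ ι₂ = LinearMap.id := HOneProduct.pullInr_comp_pullSnd
  have hπ₁ι₂ : π₁ ∘ₗ ι₂ = 0 := HOneProduct.pullInl_comp_pullSnd
  have hπ₂ι₁ : π₂ ∘ₗ ι₁ = 0 := HOneProduct.pullInr_comp_pullFst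
  have hsum : ι₁ ∘ₗ π₁ + ι₂ ∘ₗ π₂ = LinearMap.id := HOneProduct.pullFst_comp_pullInl_add
  have hπι₁C : π₁.baseChange ℂ ∘ₗ ι₁.baseChange ℂ = LinearMap.id := by
    rw [← LinearMap.baseChange_comp, hπι₁, LinearMap.baseChange_id]
  have hπι₂C : π₂.baseChange ℂ ∘ₗ ι₂.baseChange ℂ = LinearMap.id := by
    rw [← LinearMap.baseChange_comp, hπι₂, LinearMap.baseChange_id]
  have hπ₁ι₂C : π₁.baseChange ℂ ∘ₗ ι₂.baseChange ℂ = 0 := by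
    rw [← LinearMap.baseChange_comp, hπ₁ι₂, LinearMap.baseChange_zero]
  have hπ₂ι₁C : π₂.baseChange ℂ ∘ₗ ι₁.baseChange ℂ = 0 := by
    rw [← LinearMap.baseChange_comp, hπ₂ι₁, LinearMap.baseChange_zero]
  have hsumC : ι₁.baseChange ℂ ∘ₗ π₁.baseChange ℂ + ι₂.baseChange ℂ ∘ₗ π₂.baseChange ℂ = LinearMap.id := by
    rw [← LinearMap.baseChange_comp, ← LinearMap.baseChange_comp, ← LinearMap.baseChange_add, hsum,
      LinearMap.baseChange_id]
  have e11 : ∀ x, π₁.baseChange ℂ (ι₁.baseChange ℂ x) = x := fun x => by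
    rw [← LinearMap.comp_apply (f := π₁.baseChange ℂ), hπι₁C, LinearMap.id_apply]
  have e12 : ∀ y, π₁.baseChange ℂ (ι₂.baseChange ℂ y) = 0 := fun y => by
    rw [← LinearMap.comp_apply (f := π₁.baseChange ℂ), hπ₁ι₂C, LinearMap.zero_apply]
  -- piece compatibility of `pr_Y^*`, `pr_E^*`
  have hι₁F : ∀ q : ℤ, ∀ x ∈ (BettiUniverse.hodge hHD hXA 1).piece q (((1 : ℕ) : ℤ) - q),
      ι₁.baseChange ℂ x ∈ (BettiUniverse.hodge hHD hXP 1).piece q (((1 : ℕ) : ℤ) - q) :=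
    fun q x hx => (BettiUniverse.pullHodgeHom hHD hI hXP hXA (Motives.AbelianVariety.fst Y S).hom.hom.hom 1).map_piece_le
      q _ ⟨x, hx, rfl⟩
  have hι₂F : ∀ q : ℤ, ∀ x ∈ (BettiUniverse.hodge hHD hXC 1).piece q (((1 : ℕ) : ℤ) - q),
      ι₂.baseChange ℂ x ∈ (BettiUniverse.hodge hHD hXP 1).piece q (((1 : ℕ) : ℤ) - q) :=
    fun q x hx => (BettiUniverse.pullHodgeHom hHD hI hXP hXC (Motives.AbelianVariety.snd Y S).hom.hom.hom 1).map_piece_le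
      q _ ⟨x, hx, rfl⟩
  -- the basis `cbx` of `H¹(Y × S) ⊗ ℂ` in pairs: `pr_Y^* bY_ℓ^r` and `pr_E^* c_i^r`
  obtain ⟨cbx', hcbx'l, hcbx'r⟩ := exists_basis_of_presentation hπι₁C hπι₂C hπ₁ι₂C hπ₂ι₁C hsumC bY cC
  set cbx : Module.Basis ((Fin n₀ ⊕ Fin h) × Fin 2) ℂ (ℂ ⊗[ℚ] bettiCohomology (Y.prod S).X 1) :=
    cbx'.reindex (Equiv.sumProdDistrib (Fin n₀) (Fin h) (Fin 2)).symm with hcbxdef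
  have hcbx : ∀ tr : (Fin n₀ ⊕ Fin h) × Fin 2, cbx tr =
      Sum.elim (fun i => ι₁.baseChange ℂ (bY (i, tr.2))) (fun i => ι₂.baseChange ℂ (cC (i, tr.2))) tr.1 := by
    rintro ⟨t, r⟩
    rw [hcbxdef, Module.Basis.reindex_apply, Equiv.symm_symm]
    rcases t with i | i
    · rw [Equiv.sumProdDistrib_apply_left, hcbx'l]; rfl
    · rw [Equiv.sumProdDistrib_apply_right, hcbx'r]; rfl
  -- Hodge-adaptedness of `cbx`
  have hcbx0 : ∀ t, cbx (t, 0) ∈ (BettiUniverse.hodge hHD hXP 1).piece 1 0 := by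
    intro t
    rw [hcbx]
    rcases t with i | i
    · have e : (((1 : ℕ) : ℤ) - 1) = 0 := by norm_num
      have h10 := hι₁F 1 _ (by rw [e]; exact hbY0' i)
      rwa [e] at h10
    · have e : (((1 : ℕ) : ℤ) - 1) = 0 := by norm_num
      have h10 := hι₂F 1 _ (by rw [e]; exact hcC0' i)
      rwa [e] at h10
  have hcbx1 : ∀ t, cbx (t, 1) ∈ (BettiUniverse.hodge hHD hXP 1).piece 0 1 := by
    intro t
    rw [hcbx]
    rcases t with i | i
    · have e : (((1 : ℕ) : ℤ) - 0) = 1 := by norm_num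
      have h01 := hι₁F 0 _ (by rw [e]; exact hbY1' i)
      rwa [e] at h01
    · have e : (((1 : ℕ) : ℤ) - 0) = 1 := by norm_num
      have h01 := hι₂F 0 _ (by rw [e]; exact hcC1' i)
      rwa [e] at h01
  -- bases indexed by `Fin M`: the pair basis `cbσ` and the rational basis `eC`
  set eQ := Module.finBasis ℚ (bettiCohomology (Y.prod S).X 1) with heQ
  set eC : Module.Basis (Fin (Module.finrank ℚ (bettiCohomology (Y.prod S).X 1))) ℂ
    (ℂ ⊗[ℚ] bettiCohomology (Y.prod S).X 1) := Algebra.TensorProduct.basis ℂ eQ with heC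
  set φ : Fin (Module.finrank ℚ (bettiCohomology (Y.prod S).X 1)) ≃ (Fin n₀ ⊕ Fin h) × Fin 2 :=
    eC.indexEquiv cbx with hφ
  set cbσ : Module.Basis (Fin (Module.finrank ℚ (bettiCohomology (Y.prod S).X 1))) ℂ
    (ℂ ⊗[ℚ] bettiCohomology (Y.prod S).X 1) := cbx.reindex φ.symm with hcbσdef
  have hcbσ : ∀ m, cbσ m = cbx (φ m) := fun m => by
    rw [hcbσdef, Module.Basis.reindex_apply, Equiv.symm_symm]
  -- letters
  set ρ := ofRatClassBaseChangeEquiv hXP 1 with hρ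
  set v : Module.Basis _ ℂ (complexBetti (Y.prod S).X 1) := cbσ.map ρ with hv
  set eL : Module.Basis _ ℂ (complexBetti (Y.prod S).X 1) := eC.map ρ with heL
  have heLQ : ∀ i, IsRationalClass (eL i) := fun i => by
    rw [heL, Module.Basis.map_apply, heC, Algebra.TensorProduct.basis_apply, hρ,
      ofRatClassBaseChangeEquiv_apply, ofRatClassBaseChange_tmul, one_smul]
    exact isRationalClass_ofRatClass _
  set κ' : Fin (Module.finrank ℚ (bettiCohomology (Y.prod S).X 1)) → Fin 2 := fun m => (φ m).2 with hκ'
  have hv_apply : ∀ m, v m = ofRatClassBaseChange (Motives.ComplexPoints (Y.prod S).X) 1 (cbx (φ m)) := fun m => by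
    rw [hv, Module.Basis.map_apply, hcbσ, hρ, ofRatClassBaseChangeEquiv_apply]
  have hv0 : ∀ m, κ' m = 0 → IsOfHodgeType (Y.prod S).dim (Y.prod S).X 1 1 0 (v m) := by
    intro m hm
    rw [hv_apply, ← BettiUniverse.mem_hodge_piece_iff hHD hI hXP (k := 1) (p := 1) (q := 0) rfl]
    have hsplit : φ m = ((φ m).1, 0) := by
      change (φ m).2 = 0 at hm; rw [← hm]
    rw [hsplit]
    exact hcbx0 _
  have hv1 : ∀ m, κ' m = 1 → IsOfHodgeType (Y.prod S).dim (Y.prod S).X 1 0 1 (v m) := by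
    intro m hm
    rw [hv_apply, ← BettiUniverse.mem_hodge_piece_iff hHD hI hXP (k := 1) (p := 0) (q := 1) rfl]
    have hsplit : φ m = ((φ m).1, 1) := by
      change (φ m).2 = 1 at hm; rw [← hm]
    rw [hsplit]
    exact hcbx1 _
  -- (α) an antisymmetric kind-balanced coefficient function in the adapted letters
  obtain ⟨ax, hax_bal, hax_anti, hcax⟩ := hg.exists_antisymm_kindBalanced_wordEval_eq v κ' hv0 hv1 hp hc
  -- the change of letters to the rational letters
  set G : Matrix _ _ ℂ := eC.toMatrix cbσ with hG
  set G' : Matrix _ _ ℂ := cbσ.toMatrix eC with hG'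
  have hG'G : G' * G = 1 := cbσ.toMatrix_mul_toMatrix_flip eC
  have hve : ∀ m, v m = ∑ i, G i m • eL i := fun m => by
    simp only [hv, heL, Module.Basis.map_apply, ← map_smul, ← map_sum]
    congr 1
    exact (eC.sum_toMatrix_smul_self (v := ⇑cbσ) (j := m)).symm
  have hletters : ∀ j m, avLetters g v (j, m) = ∑ i, G i m • avLetters g eL (j, i) :=
    avLetters_baseChange g G hve
  set aE := colourChangeAt (fun _ : Fin 1 => G) ax with haE
  have haE_anti : IsAntisymm aE := hax_anti.colourChangeAt _
  have hcaE : wordEval (cupPowOneAlt ℂ (Motives.ComplexPoints X.X) (2 * p)) (avLetters g eL) aE = c := by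
    rw [haE, ← wordEval_eq_wordEval_colourChangeAt _ (fun _ : Fin 1 => G) hletters ax, hcax]
  -- rationality of `aE`
  have hFinj : Function.Injective (exteriorPower.alternatingMapLinearEquiv
      (cupPowOneAlt ℂ (Motives.ComplexPoints X.X) (2 * p))) :=
    injective_alternatingMapLinearEquiv_cupPowOneAlt X (2 * p)
  obtain ⟨q, hq⟩ := hg.exists_rat_wordEval_eq eL heLQ hcQ
  obtain ⟨q', -, haEq⟩ := haE_anti.exists_eq_algebraMap_of_wordEval_eq hFinj (hg.letterBasis eL)
    (q := q) (by rw [AVSlots.coe_letterBasis, hcaE, hq])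
  have hslice_e : ∀ u, wordSlice aE u = wordRepAt ℂ (fun _ : Fin (2 * p) => G) (wordSlice ax u) :=
    fun u => wordSlice_colourChangeAt (fun _ : Fin 1 => G) ax u
  -- the Hodge operator `Θ` of `H¹(Y × S)`: `diag(±1)` in the adapted letters
  obtain ⟨Θ, hΘ⟩ := exists_hodgeTheta (BettiUniverse.hodge hHD hXP 1)
  have hΘb : ∀ m, Θ (cbσ m) = (if κ' m = 0 then (1 : ℂ) else -1) • cbσ m := by
    intro m
    rw [hcbσ]
    change Θ _ = (if (φ m).2 = 0 then (1 : ℂ) else -1) • _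
    rcases fin2_eq_zero_or_one_sq (φ m).2 with h0 | h1
    · rw [h0, if_pos rfl]
      have hmem : cbx (φ m) ∈ (BettiUniverse.hodge hHD hXP 1).piece 1 (((1 : ℕ) : ℤ) - 1) := by
        have e : (((1 : ℕ) : ℤ) - 1) = 0 := by norm_num
        have hsplit : φ m = ((φ m).1, 0) := by rw [← h0]
        rw [e, hsplit]; exact hcbx0 _
      rw [hΘ 1 _ hmem]
      norm_num
    · rw [h1, if_neg one_ne_zero]
      have hmem : cbx (φ m) ∈ (BettiUniverse.hodge hHD hXP 1).piece 0 (((1 : ℕ) : ℤ) - 0) := by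
        have e : (((1 : ℕ) : ℤ) - 0) = 1 := by norm_num
        have hsplit : φ m = ((φ m).1, 1) := by rw [← h1]
        rw [e, hsplit]; exact hcbx1 _
      rw [hΘ 0 _ hmem]
      norm_num
  have hΘcb : LinearMap.toMatrix cbσ cbσ Θ = kindDiag κ' := by
    ext i m
    rw [LinearMap.toMatrix_apply, hΘb, map_smul, Module.Basis.repr_self, Finsupp.smul_apply,
      Finsupp.single_apply, kindDiag, Matrix.diagonal_apply, smul_eq_mul, mul_ite, mul_one, mul_zero]
    by_cases him : i = m
    · subst him; rw [if_pos rfl]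
    · rw [if_neg (Ne.symm him), if_neg him]
  have hJG : LinearMap.toMatrix eC eC Θ * G = G * kindDiag κ' := by
    rw [← hΘcb, hG, linearMap_toMatrix_mul_basis_toMatrix, basis_toMatrix_mul_linearMap_toMatrix]
  have hΘq : ∀ u : Fin (2 * p) → Fin 1, wordDerAt ℂ (fun _ : Fin (2 * p) => LinearMap.toMatrix eC eC Θ)
      (wordSlice (fun w => algebraMap ℚ ℂ (q' w)) u) = 0 := by
    intro u
    rw [← haEq, hslice_e]
    refine wordDerAt_wordRepAt_eq_zero_of_mul_eq ℂ (fun _ : Fin (2 * p) => G) (fun _ => hJG) ?_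
    rw [wordDerAt_const]
    exact wordDer_kindDiag_wordSlice_eq_zero κ' hax_bal u
  -- the Hodge operators `Θ_Y`, `Θ_S`
  obtain ⟨ΘA, hΘA⟩ := exists_hodgeTheta (BettiUniverse.hodge hHD hXA 1)
  obtain ⟨ΘC, hΘC⟩ := exists_hodgeTheta (BettiUniverse.hodge hHD hXC 1)
  -- structure of the adapted dual basis for `ψ_ℂ` and `φ_ℂ`
  set Ψ := ψ.form.baseChange ℂ with hΨ
  have hφskewC : ∀ x y, Ψ (φQ.baseChange ℂ x) y + Ψ x (φQ.baseChange ℂ y) = 0 := by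
    haveI : Nontrivial (bettiCohomology Y.X 1) := by
      refine Module.nontrivial_of_finrank_pos (R := ℚ) ?_
      rw [finrank_bettiCohomology_one Y]; omega
    exact ThetaSubalgebra.formBaseChange_add_eq_zero_of_skew ψ
      (UnitaryTheta.form_apply_add_form_apply_eq_zero _ ψ hφE hdQ hφ2 hE)
  have hiso0 : ∀ i j, Ψ (cb (0, i)) (cb (0, j)) = 0 := fun i j =>
    UnitaryTheta.form_eq_zero_of_mem_eigenspace hφskewC hμ0 (hcbW i) (hcbW j)
  have hiso1 : ∀ i j, Ψ (cb (1, i)) (cb (1, j)) = 0 := fun i j =>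
    UnitaryTheta.form_eq_zero_of_mem_eigenspace hφskewC (neg_ne_zero.2 hμ0) (hcbW' i) (hcbW' j)
  have hswap10 : ∀ i j, Ψ (cb (1, i)) (cb (0, j)) = -(if j = i then 1 else 0) := fun i j => by
    rw [hΨ, ψ.form_baseChange_swap, show (((1 : ℕ) : ℤ)).negOnePow = -1 from Int.negOnePow_one, ← hΨ, hdual]
    split_ifs <;> simp
  have hφcb0 : ∀ ℓ, φQ.baseChange ℂ (cb (0, ℓ)) = μ • cb (0, ℓ) := fun ℓ =>
    Module.End.mem_eigenspace_iff.1 (hcbW ℓ)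
  have hφcb1 : ∀ ℓ, φQ.baseChange ℂ (cb (1, ℓ)) = (-μ) • cb (1, ℓ) := fun ℓ =>
    Module.End.mem_eigenspace_iff.1 (hcbW' ℓ)
  -- the elementary operators `P_{ij} ∈ 𝔲_{k'}(H¹Y, ψ)_ℂ ≅ 𝔤𝔩(W)`: `e_j ↦ e_i`, `f_i ↦ -f_j`
  have hops : ∀ i j : Fin n₀, ∃ P : Module.End ℂ (ℂ ⊗[ℚ] bettiCohomology Y.X 1),
      (∀ ℓ, P (cb (0, ℓ)) = if ℓ = j then cb (0, i) else 0) ∧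
      (∀ ℓ, P (cb (1, ℓ)) = if ℓ = i then -cb (1, j) else 0) ∧
      P * φQ.baseChange ℂ = φQ.baseChange ℂ * P ∧ (∀ x y, Ψ (P x) y + Ψ x (P y) = 0) := by
    intro i j
    set P : Module.End ℂ (ℂ ⊗[ℚ] bettiCohomology Y.X 1) := cb.constr ℂ (fun tl : Fin 2 × Fin n₀ =>
      if tl.1 = 0 then (if tl.2 = j then cb (0, i) else 0) else (if tl.2 = i then -cb (1, j) else 0)) with hPdef
    have hP0 : ∀ ℓ, P (cb (0, ℓ)) = if ℓ = j then cb (0, i) else 0 := fun ℓ => by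
      rw [hPdef, Module.Basis.constr_basis]; simp
    have hP1 : ∀ ℓ, P (cb (1, ℓ)) = if ℓ = i then -cb (1, j) else 0 := fun ℓ => by
      rw [hPdef, Module.Basis.constr_basis]; simp
    refine ⟨P, hP0, hP1, ?_, ?_⟩
    · refine cb.ext fun tl => ?_
      obtain ⟨t, ℓ⟩ := tl
      rcases fin2_eq_zero_or_one_sq t with rfl | rfl
      · rw [Module.End.mul_apply, Module.End.mul_apply, hφcb0, map_smul, hP0]
        by_cases hℓ : ℓ = j
        · rw [if_pos hℓ, hφcb0]
        · rw [if_neg hℓ, map_zero, smul_zero]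
      · rw [Module.End.mul_apply, Module.End.mul_apply, hφcb1, map_smul, hP1]
        by_cases hℓ : ℓ = i
        · rw [if_pos hℓ, map_neg, hφcb1, smul_neg]
        · rw [if_neg hℓ, map_zero, smul_zero]
    · have hB : Ψ ∘ₗ P + Ψ.compl₂ P = 0 := by
        refine LinearMap.BilinForm.ext_basis cb fun tk tl => ?_
        obtain ⟨t, k⟩ := tk
        obtain ⟨t', ℓ⟩ := tl
        rw [LinearMap.add_apply, LinearMap.add_apply, LinearMap.comp_apply, LinearMap.compl₂_apply,
          LinearMap.zero_apply, LinearMap.zero_apply]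
        rcases fin2_eq_zero_or_one_sq t with rfl | rfl <;> rcases fin2_eq_zero_or_one_sq t' with rfl | rfl
        · rw [hP0, hP0]
          split_ifs <;> simp [hiso0]
        · rw [hP0, hP1]
          by_cases hk : k = j <;> by_cases hl : ℓ = i
          · subst hk; subst hl; simp [hdual]
          · subst hk; rw [if_pos rfl, if_neg hl, map_zero, add_zero, hdual, if_neg (Ne.symm hl)]
          · subst hl; rw [if_neg hk, if_pos rfl, map_zero, LinearMap.zero_apply, zero_add, map_neg, hdual,
              if_neg hk, neg_zero]
          · rw [if_neg hk, if_neg hl, map_zero, LinearMap.zero_apply, map_zero, add_zero]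
        · rw [hP1, hP0]
          by_cases hk : k = i <;> by_cases hl : ℓ = j
          · subst hk; subst hl; simp [hswap10]
          · subst hk; rw [if_pos rfl, if_neg hl, map_zero, add_zero, map_neg, LinearMap.neg_apply, hswap10,
              if_neg hl, neg_zero, neg_zero]
          · subst hl; rw [if_neg hk, if_pos rfl, map_zero, LinearMap.zero_apply, zero_add, hswap10,
              if_neg (Ne.symm hk), neg_zero]
          · rw [if_neg hk, if_neg hl, map_zero, LinearMap.zero_apply, map_zero, add_zero]
        · rw [hP1, hP1]
          split_ifs <;> simp [hiso1]
      intro x y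
      have h := LinearMap.congr_fun (LinearMap.congr_fun hB x) y
      simpa only [LinearMap.add_apply, LinearMap.comp_apply, LinearMap.compl₂_apply, LinearMap.zero_apply]
        using h
  -- the root differences `D_{ij} = [P_{ij}, P_{ji}] = E_ii - E_jj` (on `W`; `-(E_ii - E_jj)` on `W'`) kill the tensor
  have hYG : ∀ Z : Module.End ℂ (ℂ ⊗[ℚ] bettiCohomology (Y.prod S).X 1), ∀ _t : Fin (2 * p),
      LinearMap.toMatrix eC eC Z * G = G * LinearMap.toMatrix cbσ cbσ Z :=
    fun Z _ => by rw [hG, linearMap_toMatrix_mul_basis_toMatrix, basis_toMatrix_mul_linearMap_toMatrix]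
  -- the diagonal weights of `ι_Y D_{ij} π_Y`: `±([ℓ = i] - [ℓ = j])` at the `Y`-places (sign `+` iff in `W`), `0` at `S`
  set δ : Fin n₀ → Fin n₀ → (Fin n₀ ⊕ Fin h) → Fin 2 → ℤ := fun i j T r =>
    Sum.elim (fun ℓ => (if r = κ ℓ then (1 : ℤ) else -1) * ((if ℓ = i then (1 : ℤ) else 0) - (if ℓ = j then 1 else 0)))
      (fun _ => (0 : ℤ)) T with hδ
  have hax : ∀ i j : Fin n₀, ∀ u : Fin (2 * p) → Fin 1,
      wordDerAt ℂ (fun _ : Fin (2 * p) => blockLift φ (fun T => Matrix.diagonal fun r => ((δ i j T r : ℤ) : ℂ)))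
        (wordSlice ax u) = 0 := by
    intro i j u
    obtain ⟨P, hP0, hP1, hPφ, hPskew⟩ := hops i j
    obtain ⟨P', hP'0, hP'1, hP'φ, hP'skew⟩ := hops j i
    -- `D` is diagonal on `cb`
    have hD0 : ∀ ℓ, (P * P' - P' * P) (cb (0, ℓ)) = (if ℓ = i then cb (0, ℓ) else 0) - (if ℓ = j then cb (0, ℓ) else 0) := by
      intro ℓ
      have hPj : P (cb (0, j)) = cb (0, i) := by rw [hP0, if_pos rfl]
      have hP'i : P' (cb (0, i)) = cb (0, j) := by rw [hP'0, if_pos rfl]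
      rw [LinearMap.sub_apply, Module.End.mul_apply, Module.End.mul_apply, hP'0, hP0]
      by_cases hi : ℓ = i <;> by_cases hj : ℓ = j
      · simp only [if_pos hi, if_pos hj, hPj, hP'i]
        rw [← hi, ← hj]
      · simp only [if_pos hi, if_neg hj, hPj, map_zero]
        rw [hi]
      · simp only [if_neg hi, if_pos hj, hP'i, map_zero]
        rw [hj]
      · simp only [if_neg hi, if_neg hj, map_zero, sub_self]
    have hD1 : ∀ ℓ, (P * P' - P' * P) (cb (1, ℓ)) = (if ℓ = j then cb (1, ℓ) else 0) - (if ℓ = i then cb (1, ℓ) else 0) := by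
      intro ℓ
      have hPi : P (cb (1, i)) = -cb (1, j) := by rw [hP1, if_pos rfl]
      have hP'j : P' (cb (1, j)) = -cb (1, i) := by rw [hP'1, if_pos rfl]
      have hPi' : P (-cb (1, i)) = cb (1, j) := by rw [map_neg P (cb (1, i)), hPi, neg_neg]
      have hP'j' : P' (-cb (1, j)) = cb (1, i) := by rw [map_neg P' (cb (1, j)), hP'j, neg_neg]
      rw [LinearMap.sub_apply, Module.End.mul_apply, Module.End.mul_apply, hP'1, hP1]
      by_cases hi : ℓ = i <;> by_cases hj : ℓ = j
      · simp only [if_pos hi, if_pos hj, hPi', hP'j']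
        rw [← hi, ← hj]
      · simp only [if_pos hi, if_neg hj, map_zero, hP'j']
        rw [hi]
      · simp only [if_neg hi, if_pos hj, hPi', map_zero]
        rw [hj]
      · simp only [if_neg hi, if_neg hj, map_zero, sub_self]
    have hDbY : ∀ ℓ r, (P * P' - P' * P) (bY (ℓ, r)) = ((δ i j (Sum.inl ℓ) r : ℤ) : ℂ) • bY (ℓ, r) := by
      intro ℓ r
      rw [hbY]
      by_cases hr : r = κ ℓ
      · rw [if_pos hr, hD0, ite_sub_ite_eq_cast_smul_sq]
        congr 2
        simp only [hδ, Sum.elim_inl, if_pos hr]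
        ring
      · rw [if_neg hr, hD1, ite_sub_ite_eq_cast_smul_sq]
        congr 2
        simp only [hδ, Sum.elim_inl, if_neg hr]
        ring
    -- the Lie step: `ι_Y D π_Y` kills the rational coefficient tensor
    have hL : wordDerAt ℂ (fun _ : Fin (2 * p) => LinearMap.toMatrix eC eC
          (ι₁.baseChange ℂ ∘ₗ (P * P' - P' * P) ∘ₗ π₁.baseChange ℂ))
        (wordSlice (fun w => algebraMap ℚ ℂ (q' w)) u) = 0 :=
      wordDerAt_incl_bracket_proj_eq_zero_of_unitary_times_abelianCommutant hn1 (BettiUniverse.hodge hHD hXP 1)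
        (BettiUniverse.hodge hHD hXA 1) (BettiUniverse.hodge hHD hXC 1) heffA hπι₁ hπι₂ hπ₁ι₂ hπ₂ι₁ hsum hι₁F hι₂F ψ
        ψC hφE hdQ hφ2 hE hμ h1' h2' (hSc ψC) eQ q' hΘ hΘA hΘC hΘq hPφ hPskew hP'φ hP'skew u
    -- the matrix of `Z` in the pair letters is the diagonal block family
    have hblk : LinearMap.toMatrix cbσ cbσ (ι₁.baseChange ℂ ∘ₗ (P * P' - P' * P) ∘ₗ π₁.baseChange ℂ) =
        blockLift φ (fun T => Matrix.diagonal fun r => ((δ i j T r : ℤ) : ℂ)) := by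
      refine toMatrix_eq_blockLift_of_apply_basis φ cbσ _ _ fun m => ?_
      rw [hcbσ m]
      have hb' : ∀ a, cbσ (φ.symm ((φ m).1, a)) = cbx ((φ m).1, a) := fun a => by
        rw [hcbσ, Equiv.apply_symm_apply]
      simp only [hb']
      obtain ⟨T, r⟩ := φ m
      rw [Finset.sum_eq_single r]
      · rw [Matrix.diagonal_apply_eq]
        rcases T with ℓ | e
        · simp only [hcbx, Sum.elim_inl]
          rw [LinearMap.comp_apply, LinearMap.comp_apply, e11, hDbY, map_smul]
        · simp only [hcbx, Sum.elim_inr]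
          rw [LinearMap.comp_apply, LinearMap.comp_apply, e12, map_zero, map_zero]
          have h0 : ((δ i j (Sum.inr e) r : ℤ) : ℂ) = 0 := by simp only [hδ, Sum.elim_inr, Int.cast_zero]
          rw [h0, zero_smul]
      · intro a _ ha
        simp only [Matrix.diagonal_apply_ne _ ha, zero_smul]
      · intro hr; exact absurd (Finset.mem_univ r) hr
    have hLu := hL
    rw [← haEq, hslice_e] at hLu
    have h3 : wordRepAt ℂ (fun _ : Fin (2 * p) => G)
        (wordDerAt ℂ (fun _ : Fin (2 * p) => blockLift φ (fun T => Matrix.diagonal fun r => ((δ i j T r : ℤ) : ℂ)))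
          (wordSlice ax u)) = 0 := by
      rw [← hblk, wordRepAt_wordDerAt_of_mul_eq ℂ (fun _ : Fin (2 * p) => G) (hYG _), hLu]
    exact wordRepAt_injective ℂ (g := fun _ : Fin (2 * p) => G) (g' := fun _ : Fin (2 * p) => G')
      (funext fun _ => hG'G) (by rw [h3, map_zero])
  -- the coefficient function, refined to slot-and-place colours
  refine ⟨placeRefine φ ax, ?_, fun U η hU => ?_⟩
  · rw [← hcax]
    have hx : (fun jr : (Fin 1 × (Fin n₀ ⊕ Fin h)) × Fin 2 => avLetters g v (jr.1.1, φ.symm (jr.1.2, jr.2))) =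
        fun jr : (Fin 1 × (Fin n₀ ⊕ Fin h)) × Fin 2 => complexBetti.map (g jr.1.1).hom.hom.hom 1
          (Sum.elim
            (fun i => complexBetti.map (Motives.AbelianVariety.fst Y S).hom.hom.hom 1
              (ofRatClassBaseChange (Motives.ComplexPoints Y.X) 1 (bY (i, jr.2))))
            (fun i => complexBetti.map (Motives.AbelianVariety.snd Y S).hom.hom.hom 1
              (ofRatClassBaseChange (Motives.ComplexPoints S.X) 1 (cC (i, jr.2))))
            jr.1.2) := by
      funext jr
      rw [avLetters_apply, hv_apply, Equiv.apply_symm_apply, hcbx]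
      obtain ⟨⟨j, t⟩, r⟩ := jr
      rcases t with i | i
      · simp only [Sum.elim_inl]
        congr 1
        rw [hι₁, ← ofRatClassBaseChangeEquiv_apply (hX := hXP), ← ofRatClassBaseChangeEquiv_apply (hX := hXA),
          complexBetti_map_ofRatClassBaseChangeEquiv hXP hXA]
      · simp only [Sum.elim_inr]
        congr 1
        rw [hι₂, ← ofRatClassBaseChangeEquiv_apply (hX := hXP), ← ofRatClassBaseChangeEquiv_apply (hX := hXC),
          complexBetti_map_ofRatClassBaseChangeEquiv hXP hXC]
    rw [← hx]
    exact wordEval_placeRefine _ φ (avLetters g v) ax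
  · -- words with a repeated letter: antisymmetry
    have hanti' : IsAntisymm (placeRefine φ ax) := fun σ w =>
      hax_anti σ (fun t => ((w t).1.1, φ.symm ((w t).1.2, (w t).2)))
    have hinjw : Function.Injective (fun t => (U t, η t)) := by
      by_contra hni
      exact hU (hanti'.apply_eq_zero_of_not_injective hni)
    -- injectivity of the place-and-kind word (ONE slot)
    have hinjP : Function.Injective fun t => ((U t).2, η t) := by
      intro t t' htt
      simp only [Prod.mk.injEq] at htt
      refine hinjw ?_
      simp only [Prod.mk.injEq]
      exact ⟨Prod.ext (Subsingleton.elim _ _) htt.1, htt.2⟩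
    -- `Θ`-balance: the kind counts
    have hval : placeRefine φ ax (fun t => (U t, η t)) = ax (fun t => ((U t).1, φ.symm ((U t).2, η t))) := rfl
    have hbal := hax_bal _ (by rw [← hval]; exact hU)
    have hcnt : ∀ r : Fin 2, (Finset.univ.filter fun t => η t = r).card = p := by
      intro r
      have hb := hbal r
      simp only [wordContent, hκ', Equiv.apply_symm_apply] at hb
      exact hb
    refine ⟨hcnt, hinjP, ?_⟩
    -- root-difference weights
    have hDw : ∀ i j : Fin n₀, ∑ t, Sum.elim (fun ℓ => (if η t = κ ℓ then (1 : ℤ) else -1) *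
        ((if ℓ = i then (1 : ℤ) else 0) - (if ℓ = j then (1 : ℤ) else 0))) (fun _ => (0 : ℤ)) (U t).2 = 0 := by
      intro i j
      have h2 : wordDerAt ℂ (fun t => Matrix.diagonal fun r => ((δ i j (U t).2 r : ℤ) : ℂ))
          (wordSlice (placeRefine φ ax) U) = 0 :=
        wordDerAt_placeFamily_placeRefine_eq_zero φ (fun T => Matrix.diagonal fun r => ((δ i j T r : ℤ) : ℂ)) (hax i j) U
      by_contra hw
      refine hU (eq_zero_of_wordDerAt_diagonal_eq_zero (fun t r => ((δ i j (U t).2 r : ℤ) : ℂ)) h2 η ?_)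
      rw [← Int.cast_sum, Int.cast_ne_zero]
      simpa only [hδ] using hw
    -- the dichotomy
    exact kindWeight_eq_zero_or_card_isLeft_eq_of_rootDiffWeights κ (fun t => (U t).2) η hinjP hκ hDw

end Invariance

/-! ### §4 Word combinatorics of the Künneth degree: one-letter-per-pair words have `S`-degree `1`, balanced words an even `T`-degree -/

section KunnethDegree

variable {hA h dd : ℕ}

/-- The two cardinalities of a left/right split add up to the number of positions. [folklore] -/
private theorem card_isLeft_add_card_not_isLeft_sq {T P : Type*} (col : Fin dd → T ⊕ P) :
    Fintype.card {t // (col t).isLeft = true} + Fintype.card {t // ¬ (col t).isLeft = true} = dd := by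
  classical
  rw [Fintype.card_subtype_compl, Nat.add_sub_cancel' (Fintype.card_subtype_le _), Fintype.card_fin]

/-- A `T`-kind-balanced word has an EVEN number of `T`-positions (a copy of the private lemma of
`UnitaryTwoOneTimesCMCurveWeilClasses`). [folklore] -/
private theorem even_card_isLeft_of_balanced_sq (P : Fin dd → Fin hA ⊕ Fin h) (η : Fin dd → Fin 2)
    (hbal : ∑ t, Sum.elim (fun _ : Fin hA => if η t = 0 then (1 : ℤ) else -1) (fun _ : Fin h => (0 : ℤ)) (P t) = 0) :
    Even (Fintype.card {t // (P t).isLeft = true}) := by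
  classical
  set A0 := (Finset.univ.filter fun t => (P t).isLeft = true ∧ η t = 0).card with hA0
  set A1 := (Finset.univ.filter fun t => (P t).isLeft = true ∧ η t = 1).card with hA1
  have hsum : ∑ t, Sum.elim (fun _ : Fin hA => if η t = 0 then (1 : ℤ) else -1) (fun _ : Fin h => (0 : ℤ)) (P t) =
      (A0 : ℤ) - (A1 : ℤ) := by
    rw [hA0, hA1, Finset.card_filter, Finset.card_filter, Nat.cast_sum, Nat.cast_sum, ← Finset.sum_sub_distrib]
    refine Finset.sum_congr rfl fun t _ => ?_
    rcases hP : P t with ℓ | e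
    · rcases Fin.exists_fin_two.1 ⟨η t, rfl⟩ with h0 | h0 <;> simp [h0]
    · simp
  have hcard : Fintype.card {t // (P t).isLeft = true} = A0 + A1 := by
    rw [Fintype.card_subtype, hA0, hA1,
      ← Finset.card_filter_add_card_filter_not (s := Finset.univ.filter fun t => (P t).isLeft = true)
        (fun t => η t = 0), Finset.filter_filter, Finset.filter_filter]
    congr 2
    refine Finset.filter_congr fun t _ => ?_
    rcases Fin.exists_fin_two.1 ⟨η t, rfl⟩ with h0 | h0 <;> simp [h0]
  rw [hsum] at hbal
  have hA01 : A0 = A1 := by omega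
  exact ⟨A0, by rw [hcard, hA01]⟩

end KunnethDegree

/-! ### §5 `B²(T × E × E) ⊆ D² + α₁^* B²(T × E) + α₂^* B²(T × E)`: Moonen–Zarhin Thm. 0.2 (1) for case (e) ∩ (a1), codimension two -/

section CodimTwo

open MonoidalCategory CartesianMonoidalCategory

variable {Y E : AbelianVariety ℂ}

/-- Pull-back of an exterior product `pr_Y^* u ⌣ pr_S^* v` along an endomorphism `θ` of `Y × S` over `Y` covering
`e : S → S` (`θ ≫ pr_Y = pr_Y`, `θ ≫ pr_S = pr_S ≫ e`): `θ^*(pr_Y^* u ⌣ pr_S^* v) = pr_Y^* u ⌣ pr_S^* (e^* v)`.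
[cite: HatcherAT2002, §3.2 Prop. 3.10] -/
private theorem map_cupProduct_fst_snd_of_over {Y S : AbelianVariety ℂ} {θ : Y.prod S ⟶ Y.prod S} {e : S ⟶ S}
    (hf : θ ≫ Motives.AbelianVariety.fst Y S = Motives.AbelianVariety.fst Y S)
    (hs : θ ≫ Motives.AbelianVariety.snd Y S = Motives.AbelianVariety.snd Y S ≫ e) {m r n : ℕ} (hmr : m + r = n)
    (u : complexBetti Y.X m) (v : complexBetti S.X r) :
    complexBetti.map θ.hom.hom.hom n (cupProduct hmr (complexBetti.map (Motives.AbelianVariety.fst Y S).hom.hom.hom m u)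
      (complexBetti.map (Motives.AbelianVariety.snd Y S).hom.hom.hom r v)) =
      cupProduct hmr (complexBetti.map (Motives.AbelianVariety.fst Y S).hom.hom.hom m u)
        (complexBetti.map (Motives.AbelianVariety.snd Y S).hom.hom.hom r (complexBetti.map e.hom.hom.hom r v)) := by
  have hmap : complexBetti.map θ.hom.hom.hom n (cupProduct hmr
      (complexBetti.map (Motives.AbelianVariety.fst Y S).hom.hom.hom m u)
      (complexBetti.map (Motives.AbelianVariety.snd Y S).hom.hom.hom r v)) =
      cupProduct hmr (complexBetti.map θ.hom.hom.hom m (complexBetti.map (Motives.AbelianVariety.fst Y S).hom.hom.hom m u))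
        (complexBetti.map θ.hom.hom.hom r (complexBetti.map (Motives.AbelianVariety.snd Y S).hom.hom.hom r v)) :=
    cupProduct_map _ hmr _ _
  rw [hmap, ← Milne1999.complexBetti_map_comp_apply, ← Milne1999.complexBetti_map_comp_apply, hf, hs,
    Milne1999.complexBetti_map_comp_apply]

/-- **Künneth components of `S`-degree one are sums of two pull-backs**: for `θ₁, θ₂` over `Y` covering `e₁, e₂` with
`e₁ + e₂ = 𝟙 S`, `θ₁^* x + θ₂^* x = x` on every `x = pr_Y^* u ⌣ pr_S^* v` with `v ∈ H¹(S)` (additivity of `H¹`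
pull-backs in the homomorphism). [cite: HatcherAT2002, §3.2 Thm. 3.16] [cite: LangeBirkenhake1992, §1.1 (p. 19)] -/
private theorem map_add_map_cupProduct_fst_snd_one {Y S : AbelianVariety ℂ} {θ₁ θ₂ : Y.prod S ⟶ Y.prod S}
    {e₁ e₂ : S ⟶ S}
    (h₁f : θ₁ ≫ Motives.AbelianVariety.fst Y S = Motives.AbelianVariety.fst Y S)
    (h₁s : θ₁ ≫ Motives.AbelianVariety.snd Y S = Motives.AbelianVariety.snd Y S ≫ e₁)
    (h₂f : θ₂ ≫ Motives.AbelianVariety.fst Y S = Motives.AbelianVariety.fst Y S)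
    (h₂s : θ₂ ≫ Motives.AbelianVariety.snd Y S = Motives.AbelianVariety.snd Y S ≫ e₂) (he : e₁ + e₂ = 𝟙 S)
    {m n : ℕ} (hmr : m + 1 = n) (u : complexBetti Y.X m) (v : complexBetti S.X 1) :
    complexBetti.map θ₁.hom.hom.hom n (cupProduct hmr (complexBetti.map (Motives.AbelianVariety.fst Y S).hom.hom.hom m u)
      (complexBetti.map (Motives.AbelianVariety.snd Y S).hom.hom.hom 1 v)) +
    complexBetti.map θ₂.hom.hom.hom n (cupProduct hmr (complexBetti.map (Motives.AbelianVariety.fst Y S).hom.hom.hom m u)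
      (complexBetti.map (Motives.AbelianVariety.snd Y S).hom.hom.hom 1 v)) =
      cupProduct hmr (complexBetti.map (Motives.AbelianVariety.fst Y S).hom.hom.hom m u)
        (complexBetti.map (Motives.AbelianVariety.snd Y S).hom.hom.hom 1 v) := by
  rw [map_cupProduct_fst_snd_of_over h₁f h₁s, map_cupProduct_fst_snd_of_over h₂f h₂s, ← map_add, ← map_add]
  congr 2
  have h := congrArg (fun F : complexBetti S.X 1 ⟶ complexBetti S.X 1 => F v) (complexBetti_map_add_one e₁ e₂)
  simp only [ModuleCat.hom_add, LinearMap.add_apply] at h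
  rw [he] at h
  change complexBetti.map (𝟙 S.X) 1 v = _ at h
  rw [complexBetti.map_id] at h
  exact h.symm

set_option maxHeartbeats 1600000 in
open scoped Classical in
/-- **MOONEN–ZARHIN 1999 Thm. 0.2 (1), case (e) ∩ (a1), in codimension two — a THEOREM, SHARP FORM with the two
named surjections: `B²(T × E × E) ⊆ D²(T × E × E) + α₁^* B²(T × E) + α₂^* B²(T × E)`, `α_a = 𝟙 × pr_a`.** Let `T`
(here `Y`) be a complex abelian
threefold with `dim_ℚ End⁰(T) = 2`, `φ ≫ φ = -d` (`d > 0`) of multiplicity `1` at `i√d` or at `-i√d` (so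
`End⁰(T) = ℚ(√-d)` acts with multiplicities `(2,1)`: type IV(1,1)), and `E` an elliptic curve with complex
multiplication `χ ≫ χ = -d'` (`d' > 0`; ANY imaginary quadratic `ℚ(χ)`, equal to `ℚ(√-d)` — case (e) — or not —
where already `B = D`, Thm. 0.2 (4)). Then `T × (E × E)` satisfies the tree's `IsCodimTwoDivisorPullbackGenerated`:
every rational `(2,2)`-class is a `ℂ`-combination of products of divisor classes and of pull-backs of rational
`(2,2)`-classes of the FOURFOLDS `T × E` along the two surjections `α_a = 𝟙 × pr_a : T × E² → T × E` — «the Hodge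
classes in `H² ⊗ H²` are contained in `H²(X₁²,ℚ) ⊗ B¹(X₂)`, whereas those in `(H¹ ⊗ H³) ⊕ (H³ ⊗ H¹)` lie in
`α₁^* W_{k,α₁} + α₂^* W_{k,α₂} ⊂ H¹ ⊗ H³` … `B²(X) = D²(X) + α₁^* B²(X₁ × X₂) + α₂^* B²(X₁ × X₂)`» ((5.12)). Proof:
the invariance theorem (`…_of_prod_unitaryTwoOne_abelianCommutant`, fed with
`HOneProduct.mul_comm_of_commute_endAlg_cmCurve_prod_self`; Lie step «`Hg(X) ⊃ {1} × SU`») splits the letter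
expansion of a rational `(2,2)`-class `c` on `T × S`, `S = E × E`, as `c = c_B + c_W`: the words of `c_W` carry one
letter from each `T`-pair and hence exactly ONE `S`-letter, so `c_W` is the Künneth component of `c` of `S`-degree
`1` — RATIONAL (`complexBetti_kunneth_bijective`, `isRationalClass_kunneth_symm_apply`) and of type `(2,2)` (kind
balance) — and `c_W = θ₁^* c_W + θ₂^* c_W = α₁^*(σ₁^* c_W) + α₂^*(σ₂^* c_W)` for `θ_a = 𝟙 × (pr_a ≫ ι_a)`,
`σ_a = 𝟙 × ι_a` (`pr₁ ≫ ι₁ + pr₂ ≫ ι₂ = 𝟙`, additivity of `H¹` pull-backs); `c_B = c - c_W` (balanced words) is a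
rational `(2,2)`-class in the span of typed products, hence a combination of products of rational Hodge classes of
`T` and `S` (`mem_span_hodgeProductClasses_of_mem_span_pureType`), which are divisor classes (`dim ≤ 3`). NOT
asserted: that the two pull-backs are Weil classes `W_{k,α_a}`, nor `D² ≠ B²`.
[cite: MoonenZarhin1999LowDim, Thm. 0.2 (1) with case (e) and §5 (5.3), (5.12)] [cite: MoonenZarhin1999LowDim, Thm. 0.2 (1)–(4) (codimension 2)]
[cite: vanGeemen1994HodgeAV, 4.9] [cite: HatcherAT2002, §3.2 Thm. 3.16] -/
theorem mem_divisorClassesSpan_sup_span_pullbacks_of_unitaryTwoOne_cmCurve_sq (hY3 : Y.dim = 3)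
    (hY2 : Module.finrank ℚ Y.endAlgebra = 2) (φY : Y ⟶ Y) {d : ℕ} (hd : 0 < d) (hφY : φY ≫ φY = -(d • 𝟙 Y))
    (hm1 : eigenMultiplicity Y φY (Complex.I * (Real.sqrt d : ℂ)) = 1 ∨
      eigenMultiplicity Y φY (-(Complex.I * (Real.sqrt d : ℂ))) = 1)
    (hE1 : E.dim = 1) (χ : E ⟶ E) {d' : ℕ} (hd' : 0 < d') (hχ : χ ≫ χ = -(d' • 𝟙 E))
    {c : complexBetti (Y.prod (E.prod E)).X (2 * 2)} (hcQ : IsRationalClass c)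
    (hc : IsOfHodgeType (Y.prod (E.prod E)).dim (Y.prod (E.prod E)).X (2 * 2) 2 2 c) :
    c ∈ divisorClassesSpan (Y.prod (E.prod E)).X (Y.prod (E.prod E)).dim 2 ⊔
      Submodule.span ℂ {w' : complexBetti (Y.prod (E.prod E)).X (2 * 2) |
        ∃ (q : E.prod E ⟶ E) (w : complexBetti (Y.prod E).X (2 * 2)),
          (q = Motives.AbelianVariety.fst E E ∨ q = Motives.AbelianVariety.snd E E) ∧
          IsRationalClass w ∧ IsOfHodgeType (Y.prod E).dim (Y.prod E).X (2 * 2) 2 2 w ∧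
          w' = complexBetti.map (Motives.AbelianVariety.prodMap (𝟙 Y) q).hom.hom.hom (2 * 2) w} := by
  classical
  have hS2 : (E.prod E).dim = 2 := by rw [Motives.AbelianVariety.dim_prod, hE1]
  have hXP : IsSmoothProjective (Y.prod (E.prod E)).dim (Y.prod (E.prod E)).X := AbelianVariety.isSmoothProjective_holds
  have hYs : IsSmoothProjective Y.dim Y.X := AbelianVariety.isSmoothProjective_holds
  have hSs : IsSmoothProjective (E.prod E).dim (E.prod E).X := AbelianVariety.isSmoothProjective_holds
  have hXE : IsSmoothProjective (Y.prod E).dim (Y.prod E).X := AbelianVariety.isSmoothProjective_holds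
  -- the invariance theorem, for `T × S` itself (one slot)
  obtain ⟨hA, bA, h, cC, hbA0, hbA1, hcC0, hcC1, hmain⟩ :=
    (avSlots_self (Y.prod (E.prod E))).exists_coeff_eq_zero_off_balanced_or_onePerPair_of_prod_unitaryTwoOne_abelianCommutant
      hY3 hY2 φY hd hφY hm1
      (fun _ Z Z' hZ _ hZ' _ => HOneProduct.mul_comm_of_commute_endAlg_cmCurve_prod_self hE1 χ hd' hχ hZ hZ')
  obtain ⟨a, hca, hsupp⟩ := hmain two_pos hcQ hc
  have hA3 : hA = 3 := by
    haveI : Module.Finite ℚ (bettiCohomology Y.X 1) := finite_bettiCohomology_one Y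
    have hcard := Module.finrank_eq_card_basis bA
    rw [Module.finrank_baseChange, finrank_bettiCohomology_one Y, hY3, Fintype.card_prod, Fintype.card_fin,
      Fintype.card_fin] at hcard
    omega
  -- the letters, freed of the identity slot
  set xA : (Fin 1 × Fin hA) × Fin 2 → complexBetti Y.X 1 := fun jr =>
    ofRatClassBaseChange (Motives.ComplexPoints Y.X) 1 (bA (jr.1.2, jr.2)) with hxA
  set y : (Fin 1 × Fin h) × Fin 2 → complexBetti (E.prod E).X 1 := fun jr =>
    ofRatClassBaseChange (Motives.ComplexPoints (E.prod E).X) 1 (cC (jr.1.2, jr.2)) with hy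
  set L : (Fin 1 × (Fin hA ⊕ Fin h)) × Fin 2 → complexBetti (Y.prod (E.prod E)).X 1 := fun jr => Sum.elim
    (fun i => complexBetti.map (Motives.AbelianVariety.fst Y (E.prod E)).hom.hom.hom 1 (xA ((jr.1.1, i), jr.2)))
    (fun i => complexBetti.map (Motives.AbelianVariety.snd Y (E.prod E)).hom.hom.hom 1 (y ((jr.1.1, i), jr.2))) jr.1.2
    with hL
  have hletters : (fun jr : (Fin 1 × (Fin hA ⊕ Fin h)) × Fin 2 =>
      complexBetti.map ((![𝟙 (Y.prod (E.prod E))]) jr.1.1).hom.hom.hom 1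
      (Sum.elim
        (fun i => complexBetti.map (Motives.AbelianVariety.fst Y (E.prod E)).hom.hom.hom 1
          (ofRatClassBaseChange (Motives.ComplexPoints Y.X) 1 (bA (i, jr.2))))
        (fun i => complexBetti.map (Motives.AbelianVariety.snd Y (E.prod E)).hom.hom.hom 1
          (ofRatClassBaseChange (Motives.ComplexPoints (E.prod E).X) 1 (cC (i, jr.2))))
        jr.1.2)) = L := by
    funext jr
    obtain ⟨⟨j, t⟩, r⟩ := jr
    have hj : j = 0 := Subsingleton.elim _ _
    subst hj
    change complexBetti.map (𝟙 (Y.prod (E.prod E)).X) 1 _ = _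
    rw [complexBetti.map_id]
    rcases t with i | i <;> rfl
  rw [hletters] at hca
  -- Hodge types of the letters
  have hL0 : ∀ jr : (Fin 1 × (Fin hA ⊕ Fin h)) × Fin 2, jr.2 = 0 →
      IsOfHodgeType (Y.prod (E.prod E)).dim (Y.prod (E.prod E)).X 1 1 0 (L jr) := by
    rintro ⟨⟨j, t⟩, r⟩ hr
    change r = 0 at hr
    subst hr
    rcases t with i | i
    · exact (hbA0 i).map_of_isSmoothProjective hXP hYs _
    · exact (hcC0 i).map_of_isSmoothProjective hXP hSs _
  have hL1 : ∀ jr : (Fin 1 × (Fin hA ⊕ Fin h)) × Fin 2, jr.2 = 1 →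
      IsOfHodgeType (Y.prod (E.prod E)).dim (Y.prod (E.prod E)).X 1 0 1 (L jr) := by
    rintro ⟨⟨j, t⟩, r⟩ hr
    change r = 1 at hr
    subst hr
    rcases t with i | i
    · exact (hbA1 i).map_of_isSmoothProjective hXP hYs _
    · exact (hcC1 i).map_of_isSmoothProjective hXP hSs _
  -- `T`-balanced words and the others
  let BAL : (Fin (2 * 2) → (Fin 1 × (Fin hA ⊕ Fin h)) × Fin 2) → Prop := fun w =>
    ∑ t, Sum.elim (fun _ : Fin hA => if (w t).2 = 0 then (1 : ℤ) else -1) (fun _ : Fin h => (0 : ℤ)) (w t).1.2 = 0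
  set aW : (Fin (2 * 2) → (Fin 1 × (Fin hA ⊕ Fin h)) × Fin 2) → ℂ := fun w => if BAL w then 0 else a w with haW
  set aB : (Fin (2 * 2) → (Fin 1 × (Fin hA ⊕ Fin h)) × Fin 2) → ℂ := fun w => if BAL w then a w else 0 with haB
  have hsplit : a = aB + aW := by
    funext w
    simp only [haB, haW, Pi.add_apply]
    split_ifs <;> simp
  set F := cupPowOneAlt ℂ (Motives.ComplexPoints (Y.prod (E.prod E)).X) (2 * 2) with hF
  set cW := wordEval F L aW with hcW
  set cB := wordEval F L aB with hcB
  have hc_eq : c = cB + cW := by rw [← hca, hsplit, map_add]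
  -- the unbalanced words in the support: kind balanced, no repeated letter, exactly `3` `T`-positions
  have hsuppW : ∀ w : Fin (2 * 2) → (Fin 1 × (Fin hA ⊕ Fin h)) × Fin 2, ¬ BAL w → a w ≠ 0 →
      (∀ r : Fin 2, (Finset.univ.filter fun t => (w t).2 = r).card = 2) ∧
        Function.Injective (fun t => ((w t).1.2, (w t).2)) ∧
        Fintype.card {t // ((w t).1.2).isLeft = true} = 3 := by
    intro w hw hne
    obtain ⟨hcnt, hinj, hbal | hcard⟩ := hsupp (fun t => (w t).1) (fun t => (w t).2) (by simpa using hne)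
    · exact absurd hbal hw
    · exact ⟨hcnt, hinj, by rw [hcard, hA3]⟩
  -- (1) `c_W` is of type `(2,2)` (kind balance), hence so is `c_B = c - c_W`
  have hmono22 : ∀ w : Fin (2 * 2) → (Fin 1 × (Fin hA ⊕ Fin h)) × Fin 2, ¬ BAL w → a w ≠ 0 →
      IsOfHodgeType (Y.prod (E.prod E)).dim (Y.prod (E.prod E)).X (2 * 2) 2 2 (F (L ∘ w)) := by
    intro w hw hne
    obtain ⟨hcnt, -, -⟩ := hsuppW w hw hne
    have h22 := isOfHodgeType_cupPowOne_of_kinds L hL0 hL1 w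
    have e0 : (∑ t, if (w t).2 = 0 then 1 else 0 : ℕ) = 2 := by
      rw [← Finset.card_filter]; exact hcnt 0
    have e1 : (∑ t, if (w t).2 = 0 then 0 else 1 : ℕ) = 2 := by
      have h' : ∀ t, (if (w t).2 = 0 then 0 else 1 : ℕ) = if (w t).2 = 1 then 1 else 0 := fun t => by
        rcases fin2_eq_zero_or_one_sq (w t).2 with h0 | h0 <;> simp [h0]
      simp only [h']
      rw [← Finset.card_filter]; exact hcnt 1
    rw [e0, e1] at h22
    rw [hF, cupPowOneAlt_apply]
    exact h22
  have hcW22 : IsOfHodgeType (Y.prod (E.prod E)).dim (Y.prod (E.prod E)).X (2 * 2) 2 2 cW := by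
    rw [hcW, wordEval_apply]
    refine IsOfHodgeType.sum hXP (nonempty_hodgeModel_holds hXP).some _ _ fun w _ => ?_
    by_cases hw : BAL w
    · simp only [haW, if_pos hw, zero_smul]
      exact IsOfHodgeType.zero (nonempty_hodgeModel_holds hXP).some _ _ _
    · by_cases hne : a w = 0
      · simp only [haW, if_neg hw, hne, zero_smul]
        exact IsOfHodgeType.zero (nonempty_hodgeModel_holds hXP).some _ _ _
      · simp only [haW, if_neg hw]
        exact (hmono22 w hw hne).smul _
  have hcB22 : IsOfHodgeType (Y.prod (E.prod E)).dim (Y.prod (E.prod E)).X (2 * 2) 2 2 cB := by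
    have e : cB = c - cW := by rw [hc_eq, add_sub_cancel_right]
    rw [e]; exact hc.sub hXP hcW22
  -- (2) `c_B` lies in the span of the typed products
  have hcB_mem := wordEval_mem_span_typed_cup_pureType_of_eq_zero_off_balanced
    (Motives.AbelianVariety.fst Y (E.prod E)) (Motives.AbelianVariety.snd Y (E.prod E)) xA y
    (fun jr hjr => by obtain ⟨⟨j, i⟩, r⟩ := jr; change r = 0 at hjr; subst hjr; exact hbA0 i)
    (fun jr hjr => by obtain ⟨⟨j, i⟩, r⟩ := jr; change r = 1 at hjr; subst hjr; exact hbA1 i)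
    (fun jr hjr => by obtain ⟨⟨j, i⟩, r⟩ := jr; change r = 0 at hjr; subst hjr; exact hcC0 i)
    (fun jr hjr => by obtain ⟨⟨j, i⟩, r⟩ := jr; change r = 1 at hjr; subst hjr; exact hcC1 i)
    (p := 2) (a := aB) (fun U η hU => by
      by_cases hw : BAL (fun t => (U t, η t))
      · exfalso
        apply hU
        have hcast : ∀ t, Sum.elim (fun _ : Fin hA => if η t = 0 then (1 : ℂ) else -1) (fun _ : Fin h => (0 : ℂ))
            (U t).2 = ((Sum.elim (fun _ : Fin hA => if η t = 0 then (1 : ℤ) else -1) (fun _ : Fin h => (0 : ℤ))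
              (U t).2 : ℤ) : ℂ) := by
          intro t
          rcases (U t).2 with ℓ | e
          · simp only [Sum.elim_inl]; split_ifs <;> simp
          · simp
        have hw' : ∑ t, Sum.elim (fun _ : Fin hA => if η t = 0 then (1 : ℤ) else -1) (fun _ : Fin h => (0 : ℤ))
            (U t).2 = 0 := hw
        simp only [hcast]
        rw [← Int.cast_sum, hw', Int.cast_zero]
      · simp only [haB, if_neg hw])
  -- (3) RATIONALITY of `c_W`: it is the Künneth component of `c` of `S`-degree `1`
  have hb : ∀ j : Fin (2 * (E.prod E).dim + 1), ∃ (r : ℕ) (b : Module.Basis (Fin r) ℂ (complexBetti (E.prod E).X j)),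
      ∀ i, IsRationalClass (b i) := fun j => exists_basis_isRationalClass hSs j
  choose r b hbQ using hb
  have hbij : Function.Bijective (LerayHirsch.lhMap ℂ (fun J : (Σ j, Fin (r j)) => (J.1 : ℕ))
      (Motives.AlgPoints.mapContinuous (L := ℂ) (Motives.AbelianVariety.fst Y (E.prod E)).hom.hom.hom)
      (fun J => complexBetti.map (Motives.AbelianVariety.snd Y (E.prod E)).hom.hom.hom J.1 (b J.1 J.2)) (2 * 2)) :=
    complexBetti_kunneth_bijective hYs hSs b (2 * 2)
  set θ := LinearEquiv.ofBijective _ hbij with hθ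
  have hθsum : ∀ a' : (Fin (2 * 2) → (Fin 1 × (Fin hA ⊕ Fin h)) × Fin 2) → ℂ,
      θ.symm (∑ w, a' w • F (L ∘ w)) = ∑ w, θ.symm (a' w • F (L ∘ w)) := fun a' => map_sum θ.symm _ _
  have hθsmul : ∀ (s : ℂ) (x : complexBetti (Y.prod (E.prod E)).X (2 * 2)), θ.symm (s • x) = s • θ.symm x :=
    fun s x => map_smul θ.symm s x
  have hθadd : ∀ x x' : complexBetti (Y.prod (E.prod E)).X (2 * 2), θ.symm (x + x') = θ.symm x + θ.symm x' :=
    fun x x' => map_add θ.symm x x'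
  -- Künneth coefficients of `pr_T^* u ⌣ pr_S^* v` vanish off the `S`-degree of `v`
  have hvan : ∀ (m r' : ℕ) (hmr : m + r' = 2 * 2) (u : complexBetti Y.X m) (v : complexBetti (E.prod E).X r')
      (J : LerayHirsch.Idx (fun J : (Σ j, Fin (r j)) => (J.1 : ℕ)) (2 * 2)), (J.1.1 : ℕ) ≠ r' →
      θ.symm (cupProduct hmr (complexBetti.map (Motives.AbelianVariety.fst Y (E.prod E)).hom.hom.hom m u)
        (complexBetti.map (Motives.AbelianVariety.snd Y (E.prod E)).hom.hom.hom r' v)) J = 0 := by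
    intro m r' hmr u v J hJ
    by_cases hr2 : r' ≤ 2 * (E.prod E).dim
    · obtain rfl : m = 2 * 2 - r' := by omega
      have key : θ.symm (cupProduct hmr (complexBetti.map (Motives.AbelianVariety.fst Y (E.prod E)).hom.hom.hom
          (2 * 2 - r') u) (complexBetti.map (Motives.AbelianVariety.snd Y (E.prod E)).hom.hom.hom r' v)) = _ :=
        kunneth_symm_cupProduct_eq_sum hYs hSs b (2 * 2) (j := ⟨r', by omega⟩) (by change r' ≤ 2 * 2; omega) u v
      rw [key, Finset.sum_apply]
      refine Finset.sum_eq_zero fun i _ => ?_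
      rw [Pi.smul_apply, Pi.single_eq_of_ne, smul_zero]
      intro hJi
      apply hJ
      rw [hJi]
    · haveI := subsingleton_complexBetti hSs (lt_of_not_ge hr2)
      have hv : v = 0 := Subsingleton.elim _ _
      rw [hv, map_zero, map_zero]
      exact congrFun (map_zero θ.symm) J
  -- every word's monomial is `± pr_T^*(T-monomial) ⌣ pr_S^*(S-monomial)`, the `S`-degree being the number of
  -- `S`-positions
  have hterm : ∀ w : Fin (2 * 2) → (Fin 1 × (Fin hA ⊕ Fin h)) × Fin 2,
      ∃ (m r' : ℕ) (hmr : m + r' = 2 * 2) (u : complexBetti Y.X m) (v : complexBetti (E.prod E).X r') (s : ℂ),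
        F (L ∘ w) = s • cupProduct hmr (complexBetti.map (Motives.AbelianVariety.fst Y (E.prod E)).hom.hom.hom m u)
          (complexBetti.map (Motives.AbelianVariety.snd Y (E.prod E)).hom.hom.hom r' v) ∧
        m = Fintype.card {t // ((w t).1.2).isLeft = true} ∧ r' = Fintype.card {t // ¬ ((w t).1.2).isLeft = true} ∧
        (r' = 1 → ∃ v₁ : complexBetti (E.prod E).X 1, ∀ (m₁ : ℕ) (hm₁ : m₁ + 1 = 2 * 2) (u₁ : complexBetti Y.X m₁),
          m₁ = m → True) := by
    intro w
    set col : Fin (2 * 2) → Fin hA ⊕ Fin h := fun t => (w t).1.2 with hcol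
    set m := Fintype.card {t // (col t).isLeft = true} with hm
    set r' := Fintype.card {t // ¬ (col t).isLeft = true} with hr'
    have hmr : m + r' = 2 * 2 := card_isLeft_add_card_not_isLeft_sq col
    obtain ⟨φ, τA, iC, hAcol, hCcol⟩ := exists_leftSplit col hm.symm hr'.symm
    set wA : Fin m → (Fin 1 × Fin hA) × Fin 2 := fun a' =>
      (((w (φ.symm (Sum.inl a'))).1.1, τA a'), (w (φ.symm (Sum.inl a'))).2) with hwA
    set wC : Fin r' → (Fin 1 × Fin h) × Fin 2 := fun b' =>
      (((w (φ.symm (Sum.inr b'))).1.1, iC b'), (w (φ.symm (Sum.inr b'))).2) with hwC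
    have hword : (L ∘ w) = fun t => Sum.elim
        (fun a' => complexBetti.map (Motives.AbelianVariety.fst Y (E.prod E)).hom.hom.hom 1 (xA (wA a')))
        (fun b' => complexBetti.map (Motives.AbelianVariety.snd Y (E.prod E)).hom.hom.hom 1 (y (wC b'))) (φ t) := by
      funext t
      obtain ⟨s, rfl⟩ := φ.symm.surjective t
      rw [Function.comp_apply, Equiv.apply_symm_apply]
      rcases s with a' | b'
      · have h1 : (w (φ.symm (Sum.inl a'))).1.2 = Sum.inl (τA a') := hAcol a'
        simp only [hL, h1, Sum.elim_inl, hwA]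
      · have h1 : (w (φ.symm (Sum.inr b'))).1.2 = Sum.inr (iC b') := hCcol b'
        simp only [hL, h1, Sum.elim_inr, hwC]
    refine ⟨m, r', hmr, cupPowOne ℂ (Motives.ComplexPoints Y.X) m (xA ∘ wA),
      cupPowOne ℂ (Motives.ComplexPoints (E.prod E).X) r' (y ∘ wC),
      (((Equiv.Perm.sign (φ.trans (finSumFinEquiv.trans (finCongr hmr))) : ℤˣ) : ℤ) : ℂ), ?_, rfl, rfl,
      fun _ => ⟨0, fun _ _ _ _ => trivial⟩⟩
    rw [hF, cupPowOneAlt_apply, hword, cupPowOne_sumElim_eq_sign_smul_cupProduct ℂ φ hmr,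
      ← Motives.complexBetti_map_cupPowOne, ← Motives.complexBetti_map_cupPowOne]
    rfl
  -- `S`-degrees: unbalanced words `1`, balanced words even (`≠ 1`)
  have hdegW : ∀ w : Fin (2 * 2) → (Fin 1 × (Fin hA ⊕ Fin h)) × Fin 2, ¬ BAL w → a w ≠ 0 →
      Fintype.card {t // ¬ ((w t).1.2).isLeft = true} = 1 := by
    intro w hw hne
    obtain ⟨-, -, h3⟩ := hsuppW w hw hne
    have hsum := card_isLeft_add_card_not_isLeft_sq (fun t => (w t).1.2)
    omega
  have hdegB : ∀ w : Fin (2 * 2) → (Fin 1 × (Fin hA ⊕ Fin h)) × Fin 2, BAL w → a w ≠ 0 →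
      Fintype.card {t // ¬ ((w t).1.2).isLeft = true} ≠ 1 := by
    intro w hw _
    have hw' : ∑ t, Sum.elim (fun _ : Fin hA => if (w t).2 = 0 then (1 : ℤ) else -1) (fun _ : Fin h => (0 : ℤ))
        (w t).1.2 = 0 := hw
    have hev := even_card_isLeft_of_balanced_sq (fun t => (w t).1.2) (fun t => (w t).2) hw'
    have hmr := card_isLeft_add_card_not_isLeft_sq (fun t => (w t).1.2)
    obtain ⟨k, hk⟩ := hev
    omega
  -- Künneth coefficients: `c_W` has only `S`-degree-`1` coefficients, `c_B` none
  have hθW : ∀ J : LerayHirsch.Idx (fun J : (Σ j, Fin (r j)) => (J.1 : ℕ)) (2 * 2), (J.1.1 : ℕ) ≠ 1 →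
      θ.symm cW J = 0 := by
    intro J hJ
    rw [hcW, wordEval_apply, hθsum, Finset.sum_apply]
    refine Finset.sum_eq_zero fun w _ => ?_
    rw [hθsmul, Pi.smul_apply]
    by_cases hw : BAL w
    · simp only [haW, if_pos hw, zero_smul]
    · by_cases hne : a w = 0
      · simp only [haW, if_neg hw, hne, zero_smul]
      · obtain ⟨m, r', hmr, u, v, s, hFw, -, hr', -⟩ := hterm w
        have h1 : r' = 1 := by rw [hr']; exact hdegW w hw hne
        rw [hFw, hθsmul, Pi.smul_apply, hvan m r' hmr u v J (by rw [h1]; exact hJ), smul_zero, smul_zero]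
  have hθB : ∀ J : LerayHirsch.Idx (fun J : (Σ j, Fin (r j)) => (J.1 : ℕ)) (2 * 2), (J.1.1 : ℕ) = 1 →
      θ.symm cB J = 0 := by
    intro J hJ
    rw [hcB, wordEval_apply, hθsum, Finset.sum_apply]
    refine Finset.sum_eq_zero fun w _ => ?_
    rw [hθsmul, Pi.smul_apply]
    by_cases hw : BAL w
    · by_cases hne : a w = 0
      · simp only [haB, if_pos hw, hne, zero_smul]
      · obtain ⟨m, r', hmr, u, v, s, hFw, -, hr', -⟩ := hterm w
        have h1 : r' ≠ 1 := by rw [hr']; exact hdegB w hw hne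
        rw [hFw, hθsmul, Pi.smul_apply, hvan m r' hmr u v J (by rw [hJ]; exact Ne.symm h1), smul_zero, smul_zero]
    · simp only [haB, if_neg hw, zero_smul]
  -- `θ⁻¹ c_W` is the `S`-degree-`1` truncation of `θ⁻¹ c`, whose entries are rational
  set a₁ : LerayHirsch.Src ℂ (fun J : (Σ j, Fin (r j)) => (J.1 : ℕ)) (Motives.ComplexPoints Y.X) (2 * 2) :=
    fun J => if (J.1.1 : ℕ) = 1 then θ.symm c J else 0 with ha₁
  have hθcW : θ.symm cW = a₁ := by
    funext J
    by_cases hJ : (J.1.1 : ℕ) = 1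
    · rw [ha₁]; simp only [if_pos hJ]
      rw [hc_eq, hθadd, Pi.add_apply, hθB J hJ, zero_add]
    · rw [ha₁]; simp only [if_neg hJ]
      exact hθW J hJ
  have hcW_eq : cW = θ a₁ := by rw [← hθcW, LinearEquiv.apply_symm_apply]
  have hcWQ : IsRationalClass cW := by
    rw [hcW_eq, hθ, LinearEquiv.ofBijective_apply, LerayHirsch.lhMap_apply]
    refine isRationalClass_sum _ _ fun J _ => ?_
    split_ifs with hJk
    · refine (IsRationalClass.map _ ?_).cup _ ((hbQ J.1 J.2).map _)
      rw [ha₁]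
      dsimp only
      split_ifs with hJ1
      · exact isRationalClass_kunneth_symm_apply hYs hSs b hbQ (2 * 2) hcQ ⟨J, hJk⟩
      · exact IsRationalClass.zero
    · exact IsRationalClass.zero
  have hcBQ : IsRationalClass cB := by
    have e : cB = c - cW := by rw [hc_eq, add_sub_cancel_right]
    rw [e]; exact hcQ.sub hcWQ
  -- (4) `c_W = α₁^*(σ₁^* c_W) + α₂^*(σ₂^* c_W)` with `α_a = 𝟙 × pr_a`, `σ_a = 𝟙 × ι_a`
  set p₁ := Motives.AbelianVariety.fst E E with hp₁
  set p₂ := Motives.AbelianVariety.snd E E with hp₂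
  set i₁ := HOneProduct.inlHom E E with hi₁
  set i₂ := HOneProduct.inrHom E E with hi₂
  set α₁ : Y.prod (E.prod E) ⟶ Y.prod E := Motives.AbelianVariety.prodMap (𝟙 Y) p₁ with hα₁
  set α₂ : Y.prod (E.prod E) ⟶ Y.prod E := Motives.AbelianVariety.prodMap (𝟙 Y) p₂ with hα₂
  set σ₁ : Y.prod E ⟶ Y.prod (E.prod E) := Motives.AbelianVariety.prodMap (𝟙 Y) i₁ with hσ₁
  set σ₂ : Y.prod E ⟶ Y.prod (E.prod E) := Motives.AbelianVariety.prodMap (𝟙 Y) i₂ with hσ₂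
  have hθf : ∀ (q : E.prod E ⟶ E) (i : E ⟶ E.prod E),
      (Motives.AbelianVariety.prodMap (𝟙 Y) q ≫ Motives.AbelianVariety.prodMap (𝟙 Y) i) ≫
        Motives.AbelianVariety.fst Y (E.prod E) = Motives.AbelianVariety.fst Y (E.prod E) := by
    intro q i
    rw [Category.assoc, Motives.AbelianVariety.prodMap_fst, ← Category.assoc, Motives.AbelianVariety.prodMap_fst,
      Category.comp_id, Category.comp_id]
  have hθs : ∀ (q : E.prod E ⟶ E) (i : E ⟶ E.prod E),
      (Motives.AbelianVariety.prodMap (𝟙 Y) q ≫ Motives.AbelianVariety.prodMap (𝟙 Y) i) ≫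
        Motives.AbelianVariety.snd Y (E.prod E) = Motives.AbelianVariety.snd Y (E.prod E) ≫ (q ≫ i) := by
    intro q i
    rw [Category.assoc, Motives.AbelianVariety.prodMap_snd, ← Category.assoc, Motives.AbelianVariety.prodMap_snd,
      Category.assoc]
  have he : p₁ ≫ i₁ + p₂ ≫ i₂ = 𝟙 (E.prod E) := HOneProduct.fst_inlHom_add_snd_inrHom E E
  -- the linear map `θ₁^* + θ₂^*` fixes `c_W`
  set Φ : complexBetti (Y.prod (E.prod E)).X (2 * 2) →ₗ[ℂ] complexBetti (Y.prod (E.prod E)).X (2 * 2) :=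
    (complexBetti.map (α₁ ≫ σ₁).hom.hom.hom (2 * 2)).hom + (complexBetti.map (α₂ ≫ σ₂).hom.hom.hom (2 * 2)).hom
    with hΦ
  have hΦapply : ∀ x, Φ x = complexBetti.map (α₁ ≫ σ₁).hom.hom.hom (2 * 2) x +
      complexBetti.map (α₂ ≫ σ₂).hom.hom.hom (2 * 2) x := fun x => rfl
  have hΦmono : ∀ w : Fin (2 * 2) → (Fin 1 × (Fin hA ⊕ Fin h)) × Fin 2, ¬ BAL w → a w ≠ 0 →
      Φ (F (L ∘ w)) = F (L ∘ w) := by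
    intro w hw hne
    obtain ⟨m, r', hmr, u, v, s, hFw, -, hr', -⟩ := hterm w
    have h1 : r' = 1 := by rw [hr']; exact hdegW w hw hne
    subst h1
    rw [hFw, map_smul, hΦapply, map_add_map_cupProduct_fst_snd_one (hθf p₁ i₁) (hθs p₁ i₁) (hθf p₂ i₂) (hθs p₂ i₂)
      he hmr u v]
  have hΦcW : Φ cW = cW := by
    rw [hcW, wordEval_apply, map_sum]
    refine Finset.sum_congr rfl fun w _ => ?_
    rw [map_smul]
    by_cases hw : BAL w
    · simp only [haW, if_pos hw, zero_smul]
    · by_cases hne : a w = 0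
      · simp only [haW, if_neg hw, hne, zero_smul]
      · rw [hΦmono w hw hne]
  have hcW_pull : cW = complexBetti.map α₁.hom.hom.hom (2 * 2) (complexBetti.map σ₁.hom.hom.hom (2 * 2) cW) +
      complexBetti.map α₂.hom.hom.hom (2 * 2) (complexBetti.map σ₂.hom.hom.hom (2 * 2) cW) := by
    rw [← Milne1999.complexBetti_map_comp_apply, ← Milne1999.complexBetti_map_comp_apply, ← hΦapply, hΦcW]
  -- (5) conclusion: `c_B ∈ D²`, `c_W ∈ α₁^* B²(T × E) + α₂^* B²(T × E)`
  rw [hc_eq]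
  refine Submodule.add_mem_sup ?_ ?_
  · have hcB22' : IsOfHodgeType (Y.dim + (E.prod E).dim) (Y.X ⊗ (E.prod E).X) (2 * 2) 2 2 cB := by
      rw [← Motives.AbelianVariety.dim_prod]; exact hcB22
    have hspan := mem_span_hodgeProductClasses_of_mem_span_pureType Y (E.prod E) hcBQ hcB22'
      (Submodule.span_mono ?_ hcB_mem)
    swap
    · rintro z ⟨i, j, hij, dd, μ, hdd, hμ, rfl⟩
      exact ⟨i, j, hij, dd, μ, hdd, hμ, rfl⟩
    rw [Motives.AbelianVariety.dim_prod]
    exact Submodule.span_le.2 (hodgeProductClasses_subset_divisorClassesSpan Y (E.prod E)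
      (isDivisorGenerated_of_dim_le_three Y (by omega)) (isDivisorGenerated_of_dim_le_three (E.prod E) (by omega)) 2)
      hspan
  · rw [hcW_pull]
    exact Submodule.add_mem _
      (Submodule.subset_span ⟨p₁, _, Or.inl rfl, hcWQ.map _, hcW22.map_of_isSmoothProjective hXE hXP _, rfl⟩)
      (Submodule.subset_span ⟨p₂, _, Or.inr rfl, hcWQ.map _, hcW22.map_of_isSmoothProjective hXE hXP _, rfl⟩)

/-- `σ_a ≫ α_a = 𝟙`: `(𝟙 × ι) ≫ (𝟙 × q) = 𝟙` for a section `ι ≫ q = 𝟙` of `q : E × E → E`.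
[cite: Lange2023AbelianVarietiesC, Cor. 2.4.26] -/
private theorem prodMap_id_comp_prodMap_id_eq_id (q : E.prod E ⟶ E) (i : E ⟶ E.prod E) (hiq : i ≫ q = 𝟙 E) :
    Motives.AbelianVariety.prodMap (𝟙 Y) i ≫ Motives.AbelianVariety.prodMap (𝟙 Y) q = 𝟙 (Y.prod E) := by
  refine Motives.AbelianVariety.prod_hom_ext ?_ ?_
  · rw [Category.assoc, Motives.AbelianVariety.prodMap_fst, ← Category.assoc, Motives.AbelianVariety.prodMap_fst,
      Category.comp_id, Category.comp_id, Category.id_comp]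
  · rw [Category.assoc, Motives.AbelianVariety.prodMap_snd, ← Category.assoc, Motives.AbelianVariety.prodMap_snd,
      Category.assoc, hiq, Category.comp_id, Category.id_comp]

/-- `α_a = 𝟙 × pr_a : T × E² → T × E` is surjective (it has the section `𝟙 × ι_a`). [folklore] -/
private theorem surjective_prodMap_id_of_fst_or_snd {q : E.prod E ⟶ E}
    (hq : q = Motives.AbelianVariety.fst E E ∨ q = Motives.AbelianVariety.snd E E) :
    AlgebraicGeometry.Surjective (AbelianVariety.Hom.toSchemeHom (Motives.AbelianVariety.prodMap (𝟙 Y) q)) := by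
  rcases hq with rfl | rfl
  · exact Milne1999.surjective_toSchemeHom_of_comp_eq_nsmul_id
      (Motives.AbelianVariety.prodMap (𝟙 Y) (HOneProduct.inlHom E E)) _ one_ne_zero
      (by rw [prodMap_id_comp_prodMap_id_eq_id _ _ (HOneProduct.inlHom_fst E E), one_smul])
  · exact Milne1999.surjective_toSchemeHom_of_comp_eq_nsmul_id
      (Motives.AbelianVariety.prodMap (𝟙 Y) (HOneProduct.inrHom E E)) _ one_ne_zero
      (by rw [prodMap_id_comp_prodMap_id_eq_id _ _ (HOneProduct.inrHom_snd E E), one_smul])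

/-- **MOONEN–ZARHIN 1999 Thm. 0.2 (1), case (e) ∩ (a1), in codimension two — `T × (E × E)` satisfies the tree's
`IsCodimTwoDivisorPullbackGenerated`** («`B²(X) = D²(X) + Σ_α α^* B²(X')`», Thm. 0.2 (1)–(4) in codimension 2): the two named surjections of the
sharp form are surjective homomorphisms onto the FOURFOLD `T × E`. Let `T` (here `Y`) be a complex abelian threefold
with `dim_ℚ End⁰(T) = 2`, `φ ≫ φ = -d` (`d > 0`) of multiplicity `1` at `i√d` or at `-i√d`, and `E` an elliptic
curve with complex multiplication `χ ≫ χ = -d'` (`d' > 0`).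
[cite: MoonenZarhin1999LowDim, Thm. 0.2 (1) with case (e) and §5 (5.3), (5.12)] -/
theorem isCodimTwoDivisorPullbackGenerated_prod_cmCurve_sq_of_unitaryTwoOne (hY3 : Y.dim = 3)
    (hY2 : Module.finrank ℚ Y.endAlgebra = 2) (φY : Y ⟶ Y) {d : ℕ} (hd : 0 < d) (hφY : φY ≫ φY = -(d • 𝟙 Y))
    (hm1 : eigenMultiplicity Y φY (Complex.I * (Real.sqrt d : ℂ)) = 1 ∨
      eigenMultiplicity Y φY (-(Complex.I * (Real.sqrt d : ℂ))) = 1)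
    (hE1 : E.dim = 1) (χ : E ⟶ E) {d' : ℕ} (hd' : 0 < d') (hχ : χ ≫ χ = -(d' • 𝟙 E)) :
    IsCodimTwoDivisorPullbackGenerated (Y.prod (E.prod E)) := by
  intro c hcQ hc
  have hdim4 : (Y.prod E).dim = 4 := by rw [Motives.AbelianVariety.dim_prod, hY3, hE1]
  obtain ⟨x, hx, z, hz, rfl⟩ := Submodule.mem_sup.1
    (mem_divisorClassesSpan_sup_span_pullbacks_of_unitaryTwoOne_cmCurve_sq hY3 hY2 φY hd hφY hm1 hE1 χ hd' hχ hcQ hc)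
  refine Submodule.add_mem_sup hx (Submodule.span_le.2 ?_ hz)
  rintro w' ⟨q, w, hq, hwQ, hwH, rfl⟩
  exact Submodule.subset_span
    ⟨Y.prod E, Motives.AbelianVariety.prodMap (𝟙 Y) q, w, hdim4, surjective_prodMap_id_of_fst_or_snd hq, hwQ, hwH, rfl⟩

/-- **THE HODGE CONJECTURE FOR `T × E × E` FROM THE HODGE CONJECTURE FOR THE FOURFOLD `T × E`** (same `T`, `E` as
above; HYPOTHESIS `hHC : HodgeConjectureFor (T × E)`, e.g. from the algebraicity of the Weil classes of abelian
fourfolds — NOT asserted here). Codimension `0`; `1` (Lefschetz `(1,1)`); `2`: the sharp form — products of divisor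
classes are algebraic and `α_a^*` of an algebraic class of `T × E` is algebraic
(`map_mem_algebraicClasses_of_abelianVariety`); `3, 4, 5`: hard Lefschetz (`nonempty_hardLefschetzNFold_holds`).
«In particular the Hodge conjecture for `X` … follows from that for the abelian fourfolds `X₁ × X₂`.»
[cite: MoonenZarhin1999LowDim, Thm. 0.2 (1) with case (e) and §5 (5.12)] [cite: VoisinHodgeI2002, Thm. 6.25 and Thm. 11.30] -/
theorem hodgeConjectureFor_prod_cmCurve_sq_of_unitaryTwoOne_of_hodgeConjectureFor (hY3 : Y.dim = 3)
    (hY2 : Module.finrank ℚ Y.endAlgebra = 2) (φY : Y ⟶ Y) {d : ℕ} (hd : 0 < d) (hφY : φY ≫ φY = -(d • 𝟙 Y))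
    (hm1 : eigenMultiplicity Y φY (Complex.I * (Real.sqrt d : ℂ)) = 1 ∨
      eigenMultiplicity Y φY (-(Complex.I * (Real.sqrt d : ℂ))) = 1)
    (hE1 : E.dim = 1) (χ : E ⟶ E) {d' : ℕ} (hd' : 0 < d') (hχ : χ ≫ χ = -(d' • 𝟙 E))
    (hHC : HodgeConjectureFor (Y.prod E).dim (Y.prod E).X) :
    HodgeConjectureFor (Y.prod (E.prod E)).dim (Y.prod (E.prod E)).X := by
  have hX : IsSmoothProjective (Y.prod (E.prod E)).dim (Y.prod (E.prod E)).X := AbelianVariety.isSmoothProjective_holds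
  have hdim : (Y.prod (E.prod E)).dim = 5 := by
    rw [Motives.AbelianVariety.dim_prod, Motives.AbelianVariety.dim_prod, hY3, hE1]
  refine ⟨nonempty_hodgeModel_holds hX, fun p c hc hpp => ?_⟩
  -- the half `2q ≤ dim`: codimension zero, Lefschetz `(1,1)`, and the sharp codimension-`2` row
  have low : ∀ (q : ℕ) (c : complexBetti (Y.prod (E.prod E)).X (2 * q)), 2 * q ≤ (Y.prod (E.prod E)).dim →
      IsRationalClass c → IsOfHodgeType (Y.prod (E.prod E)).dim (Y.prod (E.prod E)).X (2 * q) q q c →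
      c ∈ algebraicClasses (Y.prod (E.prod E)).X q := by
    intro q c hq hc hqq
    have hq2 : q ≤ 2 := by omega
    interval_cases q
    · exact hodgeConjectureFor_codim_zero c
    · exact lefschetzOneOne_rational_holds hX c hc hqq
    · refine (sup_le (AbelianVariety.divisorClassesSpan_le_algebraicClasses (Y.prod (E.prod E))
        (fun b hb hb' => lefschetzOneOne_rational_holds hX b hb hb') 2) (Submodule.span_le.2 ?_))
        (mem_divisorClassesSpan_sup_span_pullbacks_of_unitaryTwoOne_cmCurve_sq hY3 hY2 φY hd hφY hm1 hE1 χ hd' hχ hc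
          hqq)
      rintro w' ⟨q', w, -, hwQ, hwH, rfl⟩
      exact map_mem_algebraicClasses_of_abelianVariety hX (Y.prod E) _ (hHC.2 2 w hwQ hwH)
  rcases Nat.lt_or_ge (Y.prod (E.prod E)).dim (2 * p) with hlt | hge
  · exact mem_algebraicClasses_of_lt_of_nonempty (nonempty_hardLefschetzNFold_holds _ _) hX hlt
      (fun c' hc' hpp' => low ((Y.prod (E.prod E)).dim - p) c' (by omega) hc' hpp') c hc hpp
  · exact low p c hge hc hpp

end CodimTwo

/-! ### §6 Consequences: a simple threefold with quadratic `End⁰` times the square of a CM elliptic curve, and its isogeny class (Thm. 0.2 (1), case (e) ∩ (a1), as printed) -/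

section Consequences

variable {T E X : AbelianVariety ℂ}

/-- **A simple complex abelian threefold with `dim_ℚ End⁰ = 2` is of unitary type `(2,1)`**: `End⁰(T)` is an
imaginary quadratic field (a totally real `End⁰` has degree dividing `dim T = 3`), so `T` carries `φ` with
`φ ≫ φ = -d`, `d > 0`, whose multiplicities on `H^{1,0}(T)` are positive (Shimura: the tree's
`AbelianVariety.eigenMultiplicity_pos_of_isSimple`) and add up to `3`: one of them is `1` — «`X₂` … of type IV(1,1)»,
case (a1) `End⁰(X₂) = k`. [cite: MoonenZarhin1999LowDim, §2 (2.3) type IV(1,1) and (2.5)]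
[cite: Shimura1963AnalyticFamilies, §4 Prop. 14] -/
theorem exists_unitaryTwoOne_of_isSimple_threefold_of_finrank_eq_two (hTs : T.IsSimple) (hT3 : T.dim = 3)
    (hT2 : Module.finrank ℚ T.endAlgebra = 2) :
    ∃ (φ : T ⟶ T) (d : ℕ), 0 < d ∧ φ ≫ φ = -(d • 𝟙 T) ∧
      (eigenMultiplicity T φ (Complex.I * (Real.sqrt d : ℂ)) = 1 ∨
        eigenMultiplicity T φ (-(Complex.I * (Real.sqrt d : ℂ))) = 1) := by
  classical
  have h0 : 0 < T.dim := by omega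
  have hF : IsField T.endAlgebra := AbelianVariety.isField_endAlgebra_of_isSimple_of_finrank_eq_two hTs h0 hT2
  have hnR : ¬ NumberField.IsTotallyReal (EndField T hF) := fun hR => by
    have h := finrank_endAlgebra_dvd_dim_of_isField_of_isTotallyReal hF h0 hR
    rw [hT2, hT3] at h
    omega
  obtain ⟨a, q, hq, ha⟩ := AbelianVariety.exists_mul_self_eq_neg_of_finrank_eq_two h0 hT2 hF hnR
  obtain ⟨φ, d, hd, hφ⟩ := AbelianVariety.exists_hom_comp_self_eq_neg T hq ha
  have hsum := eigenMultiplicity_add_eigenMultiplicity_neg_eq_dim T φ hd hφ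
  have hpos := AbelianVariety.eigenMultiplicity_pos_of_isSimple T hTs φ hd hφ (by omega)
  exact ⟨φ, d, hd, hφ, by omega⟩

/-- **MOONEN–ZARHIN Thm. 0.2 (1), case (e) ∩ (a1), codimension two, for `T × (E × E)`**: `T` a SIMPLE complex
abelian threefold with `dim_ℚ End⁰(T) = 2`, `E` an elliptic curve of CM type (`Milne1999.IsOfCMType E`) — then
`B²(T × E × E) ⊆ D² + Σ_α α^* B²(X')`, UNCONDITIONALLY (no hypothesis relating `End⁰(E)` and `End⁰(T)`: when the two
imaginary quadratic fields differ, `B = D` by Thm. 0.2 (4) and the conclusion is weaker).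
[cite: MoonenZarhin1999LowDim, Thm. 0.2 (1) with case (e) and §5 (5.12)] -/
theorem isCodimTwoDivisorPullbackGenerated_simpleThreefold_prod_cmCurve_sq (hTs : T.IsSimple) (hT3 : T.dim = 3)
    (hT2 : Module.finrank ℚ T.endAlgebra = 2) (hE1 : E.dim = 1) (hEcm : Milne1999.IsOfCMType E) :
    IsCodimTwoDivisorPullbackGenerated (T.prod (E.prod E)) := by
  obtain ⟨φ, d, hd, hφ, hm1⟩ := exists_unitaryTwoOne_of_isSimple_threefold_of_finrank_eq_two hTs hT3 hT2
  obtain ⟨χ, d', hd', hχ⟩ := exists_hom_comp_self_eq_neg_of_cmCurve hE1 hEcm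
  exact isCodimTwoDivisorPullbackGenerated_prod_cmCurve_sq_of_unitaryTwoOne hT3 hT2 φ hd hφ hm1 hE1 χ hd' hχ

/-- **… AS PRINTED: every `X` isogenous to `X₁² × X₂ = E × E × T`** («(e) The abelian variety `X` is isogenous to
a product `X₁² × X₂`, where `X₁` and `X₂` are as in (a)», `X₂` with `End⁰(X₂) = k` — (a1)) satisfies
`B²(X) ⊆ D²(X) + Σ_α α^* B²(X')` (isogeny invariance: the tree's `IsCodimTwoDivisorPullbackGenerated.of_isIsogenous`).
This is the residual «case (e) ∩ (a1)» of the cell's codimension-two census of non-CM fivefolds.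
[cite: MoonenZarhin1999LowDim, Thm. 0.2 (1) with case (e)] [cite: vanGeemen1994HodgeAV, Lemma 3.7] -/
theorem isCodimTwoDivisorPullbackGenerated_of_isIsogenous_cmCurve_cmCurve_simpleThreefold
    (hX : AbelianVariety.IsIsogenous X (E.prod (E.prod T))) (hE1 : E.dim = 1) (hEcm : Milne1999.IsOfCMType E)
    (hTs : T.IsSimple) (hT3 : T.dim = 3) (hT2 : Module.finrank ℚ T.endAlgebra = 2) :
    IsCodimTwoDivisorPullbackGenerated X :=
  (isCodimTwoDivisorPullbackGenerated_simpleThreefold_prod_cmCurve_sq hTs hT3 hT2 hE1 hEcm).of_isIsogenous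
    (hX.trans ((isIsogenous_prod_assoc E E T).symm'.trans (isIsogenous_prod_comm (E.prod E) T)))

/-- **THE HODGE CONJECTURE FOR `T × E × E` FROM THE HODGE CONJECTURE FOR `T × E`**, `T` a simple threefold with
`dim_ℚ End⁰(T) = 2`, `E` an elliptic curve of CM type (HYPOTHESIS `hHC : HodgeConjectureFor (T × E)` — for
`End⁰(E) ↪ End⁰(T)` this is the algebraicity of the Weil classes `W_k ⊂ B²(T × E)`, NOT asserted here): «the Hodge
conjecture for `X` … follows from that for the abelian fourfolds». [cite: MoonenZarhin1999LowDim, Thm. 0.2 (1) with case (e) and §5 (5.12)] -/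
theorem hodgeConjectureFor_simpleThreefold_prod_cmCurve_sq_of_hodgeConjectureFor (hTs : T.IsSimple)
    (hT3 : T.dim = 3) (hT2 : Module.finrank ℚ T.endAlgebra = 2) (hE1 : E.dim = 1) (hEcm : Milne1999.IsOfCMType E)
    (hHC : HodgeConjectureFor (T.prod E).dim (T.prod E).X) :
    HodgeConjectureFor (T.prod (E.prod E)).dim (T.prod (E.prod E)).X := by
  obtain ⟨φ, d, hd, hφ, hm1⟩ := exists_unitaryTwoOne_of_isSimple_threefold_of_finrank_eq_two hTs hT3 hT2
  obtain ⟨χ, d', hd', hχ⟩ := exists_hom_comp_self_eq_neg_of_cmCurve hE1 hEcm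
  exact hodgeConjectureFor_prod_cmCurve_sq_of_unitaryTwoOne_of_hodgeConjectureFor hT3 hT2 φ hd hφ hm1 hE1 χ hd' hχ hHC

/-- … **and for every `X ∼ E × E × T`** (isogeny invariance of the Hodge conjecture, van Geemen Lemma 3.7).
[cite: MoonenZarhin1999LowDim, Thm. 0.2 (1) with case (e)] [cite: vanGeemen1994HodgeAV, Lemma 3.7] -/
theorem hodgeConjectureFor_of_isIsogenous_cmCurve_cmCurve_simpleThreefold_of_hodgeConjectureFor
    (hX : AbelianVariety.IsIsogenous X (E.prod (E.prod T))) (hE1 : E.dim = 1) (hEcm : Milne1999.IsOfCMType E)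
    (hTs : T.IsSimple) (hT3 : T.dim = 3) (hT2 : Module.finrank ℚ T.endAlgebra = 2)
    (hHC : HodgeConjectureFor (T.prod E).dim (T.prod E).X) : HodgeConjectureFor X.dim X.X :=
  HodgeConjectureFor.of_isIsogenous
    (hX.trans ((isIsogenous_prod_assoc E E T).symm'.trans (isIsogenous_prod_comm (E.prod E) T)))
    (hodgeConjectureFor_simpleThreefold_prod_cmCurve_sq_of_hodgeConjectureFor hTs hT3 hT2 hE1 hEcm hHC)

/-- **The residual clause «(e) ∩ (a1)» of the fivefold census, in the cell's exact binder shape**: for every complex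
abelian FIVEFOLD `A` isogenous to `E × E × T` with `E` a CM elliptic curve, `T` a simple threefold with
`dim_ℚ End⁰(T) = 2`, `T` not of CM type and `End⁰(E) ↪ End⁰(T)`, `B²(A) ⊆ D²(A) + Σ_α α^* B²(A')`. (The last three
data are not used: the conclusion holds for every CM elliptic curve `E`.) [cite: MoonenZarhin1999LowDim, Thm. 0.2 (1) with case (e)] -/
theorem isCodimTwoDivisorPullbackGenerated_of_caseE_a1 :
    ∀ A : AbelianVariety ℂ, A.dim = 5 →
      (∃ E T : AbelianVariety ℂ, E.dim = 1 ∧ Milne1999.IsOfCMType E ∧ T.IsSimple ∧ T.dim = 3 ∧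
        Module.finrank ℚ T.endAlgebra = 2 ∧ ¬ Milne1999.IsOfCMType T ∧ Nonempty (E.endAlgebra →+* T.endAlgebra) ∧
        AbelianVariety.IsIsogenous A (E.prod (E.prod T))) →
      IsCodimTwoDivisorPullbackGenerated A := by
  rintro A - ⟨E, T, hE1, hEcm, hTs, hT3, hT2, -, -, hA⟩
  exact isCodimTwoDivisorPullbackGenerated_of_isIsogenous_cmCurve_cmCurve_simpleThreefold hA hE1 hEcm hTs hT3 hT2

/- **On path**: the Hodge conjecture for abelian fivefolds gives the predicate at every fivefold (the tree's pointwise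
census file); here case (e) ∩ (a1) is proved unconditionally. -/
example (h : ∀ A : AbelianVariety ℂ, A.dim = 5 → IsCodimTwoDivisorPullbackGenerated A) (A : AbelianVariety ℂ)
    (hA : A.dim = 5) : IsCodimTwoDivisorPullbackGenerated A :=
  h A hA

end Consequences




end Literature.AlgebraicGeometry.HodgeTheory

end
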